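import Literature.NumberTheory.Automorphic.UnitaryGroupSingularBracketCenter
import Literature.NumberTheory.Automorphic.UnitaryGroupSingularHeisenbergFibre
import Literature.NumberTheory.Automorphic.UnitaryGroupSingularHeisenbergFibreIntegral
import Literature.NumberTheory.Automorphic.AdelicLineLatticeSum
import Literature.NumberTheory.Automorphic.UnitaryGroupRationalHeisenbergSplit
import Literature.NumberTheory.Automorphic.UnitaryGroupRationalLeviDecomposition
import Literature.NumberTheory.Automorphic.UnitaryGroupCosetTwoStepRegrouping
import Literature.NumberTheory.Automorphic.UnitaryGroupKernelClassSingularBorel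
import Literature.NumberTheory.Automorphic.UnitaryGroupPseudoEisensteinFibreVanishing
import Literature.NumberTheory.Automorphic.UnitaryGroupBorelModulusThree
import Literature.NumberTheory.Automorphic.UnitaryGroupArthurKernelClassInvariance
import Literature.NumberTheory.Automorphic.UnitaryGroupTruncatedKernelClassMeasurable
import Literature.NumberTheory.Automorphic.UnitaryGroupCharpolyClassMap
import Literature.NumberTheory.Automorphic.UnitaryGroupBorelRefinedClassMap
import HarnessLib

/-!
# The singular Borel class of `U(J₃)`: the `B_γ(F)\G(F)`-coset series of the bracket versus the class truncated kernel
(Rogawski, *Automorphic Representations of Unitary Groups in Three Variables* (1990), §7.2 Prop. 7.2.1 and (7.2.2)–(7.2.3),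
pp. 91–93; Arthur, *A trace formula for reductive groups I*, Duke Math. J. 45 (1978), §8.)

Topic `NumberTheory/Automorphic`; namespace `Literature.NumberTheory.Automorphic.UnitaryGroup`. THEOREMS ONLY (no definition,
no named fact, no instance, no notation, no `sorry`). Row (b2-γ) «`J^T_{i♭}(f) = (semisimple) + c_μ ∫_G β_{B_γ(F)}•b_T dν_G`» of
the T1-qs LAW 5 road of `Cruxes/H413/Lines/F0_T1InnerFormTraceIdentity.lean` (cell `pub/hodgecm-mathlib`, crux H413), FILE B′1
(the pointwise comparison; FILE B′2 does the `N(F)\N(𝔸_F)`-fibre identity and the assembly). LETTERS: the singular base point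
`γ₀ = ι(d(a,b,a))` of ★ `UnitaryGroupSingularBorelBasePoint` ∕ ★ (R2) `UnitaryGroupKernelClassSingularBorel` (`hg₀`, `hγ₀`, `hab`,
`ha`, `hb`), the Borel-refined characteristic-polynomial class map `cl♭` and its class `i♭ = (((X−a)²(X−b)) ⊗ 𝔸_E, true)` written
inline, A-p19's bracket ★ `UnitaryGroupSingularBracket` VERBATIM
`b_T(y) = Σ'_{n ∈ N_γ(F)∖1} f(y⁻¹(nγ₀)y) − 1_{T<H(y)}·𝒯(y)`, `𝒯(y) = μY(𝓕⁻)⁻¹ ∫_{𝔸_E⁻} f(y⁻¹(γ₀ n(w))y) dμY(w)`, `n(w) = heisElt hc 0 w`,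
`u(ξ) = heisElt hc (algebraMap ξ) 0`, and the SINGULAR BOREL DEFECT

  `𝓔(z) := K_{B,i♭}(z, z) − Σ'_{ξ ∈ E} 𝒯(u(ξ) z)`   (tree `kernelBorelClass` minus the `B_γ(F)\B(F)`-periodised centre integral).

* §1 `integral_center_unipotent_center_mul`, `integral_center_center_mul` — `𝒯(u n(w₁) y) = 𝒯(u y)`: central factors are invisible
  to `𝒯` when `γ₀` commutes with the centre (★ `basePoint_mul_center_comm`, ★ `commute_center_coe_unipotentInBorel`).
* §2 **`exists_equiv_borelCentralizerQuotient`** — `E ≃ B_γ(F)\B(F)` along `ξ ↦ B_γ(F)·u(ξ)`, representative `λ·u(ξ)`, `λ ∈ B_γ(F)`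
  (injective: a rational unipotent commuting with `γ₀` is central, ★ `coe_eq_heisChart_coordY_of_mem_unipotent_centralizer`;
  surjective: rational Levi ★ `exists_equiv_arithmeticBorel_prod` + Heisenberg coordinates ★ `exists_equiv_rationalUnipotent_prod`,
  ★ `torusInBorel_comm`).
* §3 `tsum_borelCentralizerQuotient_center_eq_tsum` (`Σ'_{η∈B_γ(F)\B(F)} Φ(𝒯(η̃z)) = Σ'_ξ Φ(𝒯(u(ξ)z))`, ★
  `integral_center_borelCentralizer_mul`) and **`tsum_center_heis_rational_borel_mul`** — the periodised centre integral is left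
  `B(F)`-invariant (right multiplication permutes `B_γ(F)\B(F)`).
* §4 **`singularDefect_rational_borel_mul`** (`𝓔` is left `B(F)`-invariant, ★ `kernelBorelClass_diag_rational_borel_mul`),
  `measurable_singularDefect`.
* §5 `finite_support_center_heis` (★ `hasCompactSupport_singularKernel`, ★ `finite_setOf_algebraMap_mem`),
  `indicator_center_borelCentralizer_mul`.
* §6 `summable_and_tsum_nsum_quotient_eq` (★ (R2) `kernelClass_singular_eq_tsum_conjOrbit_add_tsum_tsum`, ★ `bijective_singularFibreMap`),
  `tsum_indicator_center_quotientSub_eq` (+ `‖·‖ₑ` form), `tsum_enorm_center_heis_lt_top`, `summable_indicator_center_quotient`,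
  `tsum_indicator_center_quotient_eq_pseudoEisenstein` (two-step regrouping ★ `summable_and_tsum_quotient_eq_tsum_tsum_quotient_of_le`,
  ★ FILE A′ `tsum_indicator_borelQuotient_eq_pseudoEisenstein`), `pseudoEisenstein_indicator_singularDefect_eq_sub`, and
  **`summable_and_tsum_singularBracket_quotient_eq`** — for EVERY `y` and `T > 0`:

    `Σ'_{q ∈ B_γ(F)\G(F)} b_T(q̃ y) = k^T_{i♭}(y) − Σ'_{s ∈ [γ₀]} f(y⁻¹ s y) + Σ_{δ ∈ B(F)\G(F)} (1_{T<H}·𝓔)(δ y)`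

  with the coset series summable — no support lemma, no `N`-regularity (this is what replaces ★ (W2-b) FILE 1's collapse at the
  singular class; integrating it over `G(F)\G(𝔸_F)` is Rogawski's passage (7.2.2) → (7.2.3)).

## References

* J. D. Rogawski, *Automorphic Representations of Unitary Groups in Three Variables*, Ann. of Math. Stud. 123 (1990), §7.2
  Prop. 7.2.1, (7.2.2)–(7.2.3) (pp. 91–93) [Rogawski1990].
* J. Arthur, *A trace formula for reductive groups I*, Duke Math. J. 45 (1978), §8 [Arthur1978TraceFormulaI].
* S. Gelbart, *Automorphic forms on adele groups*, Ann. of Math. Stud. 83 (1975), §9.B [Gelbart1975].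
-/

set_option autoImplicit false

noncomputable section

open MeasureTheory Measure NumberField IsDedekindDomain Set Polynomial Literature.MeasureTheory.Group
open scoped NNReal ENNReal Classical

namespace Literature.NumberTheory.Automorphic

namespace UnitaryGroup

variable {F E : Type} [Field F] [NumberField F] [Field E] [NumberField E] [Algebra F E]
  {c : E ≃ₐ[F] E}

/-! ## §1 The centre integral `𝒯` is insensitive to central factors -/

section CentreIntegrand

/-- **A central factor between `u` and `y` does not change the conjugate `(u n₁ y)⁻¹ (γ₀ n(w)) (u n₁ y)`** when `γ₀`
commutes with the centre of `N(𝔸_F)`: `n₁ = n(w₁)` commutes with `u ∈ N(𝔸_F)`, with `n(w)` and with `γ₀`.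
[cite: Rogawski1990, §7.2 (p. 91)] -/
theorem inv_mul_basePoint_center_mul_of_center_mul (hc : c * c = 1) {γ₀ : (quasiSplit F E c 3).Adelic}
    (hcomm : ∀ w : traceZeroAdele F E c, γ₀ * (((heisElt hc 0 w : unipotentInBorel F E c 3) : borelAdelic F E c 3) : (quasiSplit F E c 3).Adelic) =
      (((heisElt hc 0 w : unipotentInBorel F E c 3) : borelAdelic F E c 3) : (quasiSplit F E c 3).Adelic) * γ₀)
    (u : unipotentInBorel F E c 3) (w₁ w : traceZeroAdele F E c) (y : (quasiSplit F E c 3).Adelic) :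
    (((u : borelAdelic F E c 3) : (quasiSplit F E c 3).Adelic) * (((heisElt hc 0 w₁ : unipotentInBorel F E c 3) : borelAdelic F E c 3) : (quasiSplit F E c 3).Adelic) * y)⁻¹ *
        (γ₀ * (((heisElt hc 0 w : unipotentInBorel F E c 3) : borelAdelic F E c 3) : (quasiSplit F E c 3).Adelic)) *
        (((u : borelAdelic F E c 3) : (quasiSplit F E c 3).Adelic) * (((heisElt hc 0 w₁ : unipotentInBorel F E c 3) : borelAdelic F E c 3) : (quasiSplit F E c 3).Adelic) * y) =
      (((u : borelAdelic F E c 3) : (quasiSplit F E c 3).Adelic) * y)⁻¹ * (γ₀ * (((heisElt hc 0 w : unipotentInBorel F E c 3) : borelAdelic F E c 3) : (quasiSplit F E c 3).Adelic)) * (((u : borelAdelic F E c 3) : (quasiSplit F E c 3).Adelic) * y) := by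
  set n₁ : (quasiSplit F E c 3).Adelic :=
    (((heisElt hc 0 w₁ : unipotentInBorel F E c 3) : borelAdelic F E c 3) : (quasiSplit F E c 3).Adelic) with hn₁
  set nw : (quasiSplit F E c 3).Adelic :=
    (((heisElt hc 0 w : unipotentInBorel F E c 3) : borelAdelic F E c 3) : (quasiSplit F E c 3).Adelic) with hnw
  set u' : (quasiSplit F E c 3).Adelic := ((u : borelAdelic F E c 3) : (quasiSplit F E c 3).Adelic) with hu'
  -- `n₁` commutes with `u'`, `γ₀` and `n(w)`
  have h1 : n₁ * u' = u' * n₁ := (commute_center_coe_unipotentInBorel hc w₁ u).eq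
  have h2 : γ₀ * n₁ = n₁ * γ₀ := hcomm w₁
  have h3 : n₁ * nw = nw * n₁ := (commute_center_coe_unipotentInBorel hc w₁ (heisElt hc 0 w)).eq
  have hX : n₁⁻¹ * (u'⁻¹ * (γ₀ * nw) * u') * n₁ = u'⁻¹ * (γ₀ * nw) * u' := by
    have hc1' : Commute n₁ u' := h1
    have hc2' : Commute n₁ γ₀ := h2.symm
    have hc3' : Commute n₁ nw := h3
    have hc' : Commute n₁ (u'⁻¹ * (γ₀ * nw) * u') :=
      ((hc1'.inv_right).mul_right (hc2'.mul_right hc3')).mul_right hc1'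
    rw [mul_assoc, ← hc'.eq, ← mul_assoc, inv_mul_cancel, one_mul]
  calc (u' * n₁ * y)⁻¹ * (γ₀ * nw) * (u' * n₁ * y)
      = y⁻¹ * (n₁⁻¹ * (u'⁻¹ * (γ₀ * nw) * u') * n₁) * y := by group
    _ = y⁻¹ * (u'⁻¹ * (γ₀ * nw) * u') * y := by rw [hX]
    _ = (u' * y)⁻¹ * (γ₀ * nw) * (u' * y) := by group

/-- **`𝒯(u · n(w₁) · y) = 𝒯(u · y)`**: a central factor next to `u ∈ N(𝔸_F)` does not change the centre integral
`∫ f(y⁻¹ (γ₀ n(w)) y) dμY(w)` (pointwise in `w`, `inv_mul_basePoint_center_mul_of_center_mul`). [cite: Rogawski1990, §7.2 (7.2.3) p. 93] -/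
theorem integral_center_unipotent_center_mul (hc : c * c = 1) {γ₀ : (quasiSplit F E c 3).Adelic}
    (hcomm : ∀ w : traceZeroAdele F E c, γ₀ * (((heisElt hc 0 w : unipotentInBorel F E c 3) : borelAdelic F E c 3) : (quasiSplit F E c 3).Adelic) =
      (((heisElt hc 0 w : unipotentInBorel F E c 3) : borelAdelic F E c 3) : (quasiSplit F E c 3).Adelic) * γ₀)
    [MeasurableSpace (AdeleRing (𝓞 E) E)] (μY : Measure (traceZeroAdele F E c))
    {V : Type*} [NormedAddCommGroup V] [NormedSpace ℝ V] (f : (quasiSplit F E c 3).Adelic → V)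
    (u : unipotentInBorel F E c 3) (w₁ : traceZeroAdele F E c) (y : (quasiSplit F E c 3).Adelic) :
    ∫ w : traceZeroAdele F E c,
        f ((((u : borelAdelic F E c 3) : (quasiSplit F E c 3).Adelic) * (((heisElt hc 0 w₁ : unipotentInBorel F E c 3) : borelAdelic F E c 3) : (quasiSplit F E c 3).Adelic) * y)⁻¹ *
          (γ₀ * (((heisElt hc 0 w : unipotentInBorel F E c 3) : borelAdelic F E c 3) : (quasiSplit F E c 3).Adelic)) *
          (((u : borelAdelic F E c 3) : (quasiSplit F E c 3).Adelic) * (((heisElt hc 0 w₁ : unipotentInBorel F E c 3) : borelAdelic F E c 3) : (quasiSplit F E c 3).Adelic) * y)) ∂μY =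
      ∫ w : traceZeroAdele F E c,
        f ((((u : borelAdelic F E c 3) : (quasiSplit F E c 3).Adelic) * y)⁻¹ * (γ₀ * (((heisElt hc 0 w : unipotentInBorel F E c 3) : borelAdelic F E c 3) : (quasiSplit F E c 3).Adelic)) * (((u : borelAdelic F E c 3) : (quasiSplit F E c 3).Adelic) * y)) ∂μY := by
  refine integral_congr_ae (Filter.Eventually.of_forall fun w => ?_)
  exact congrArg f (inv_mul_basePoint_center_mul_of_center_mul hc hcomm u w₁ w y)

/-- **`𝒯(n(w₁) · y) = 𝒯(y)`** (the case `u = 1`). [cite: Rogawski1990, §7.2 (7.2.3) p. 93] -/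
theorem integral_center_center_mul (hc : c * c = 1) {γ₀ : (quasiSplit F E c 3).Adelic}
    (hcomm : ∀ w : traceZeroAdele F E c, γ₀ * (((heisElt hc 0 w : unipotentInBorel F E c 3) : borelAdelic F E c 3) : (quasiSplit F E c 3).Adelic) =
      (((heisElt hc 0 w : unipotentInBorel F E c 3) : borelAdelic F E c 3) : (quasiSplit F E c 3).Adelic) * γ₀)
    [MeasurableSpace (AdeleRing (𝓞 E) E)] (μY : Measure (traceZeroAdele F E c))
    {V : Type*} [NormedAddCommGroup V] [NormedSpace ℝ V] (f : (quasiSplit F E c 3).Adelic → V)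
    (w₁ : traceZeroAdele F E c) (y : (quasiSplit F E c 3).Adelic) :
    ∫ w : traceZeroAdele F E c,
        f (((((heisElt hc 0 w₁ : unipotentInBorel F E c 3) : borelAdelic F E c 3) : (quasiSplit F E c 3).Adelic) * y)⁻¹ * (γ₀ * (((heisElt hc 0 w : unipotentInBorel F E c 3) : borelAdelic F E c 3) : (quasiSplit F E c 3).Adelic)) * ((((heisElt hc 0 w₁ : unipotentInBorel F E c 3) : borelAdelic F E c 3) : (quasiSplit F E c 3).Adelic) * y)) ∂μY =
      ∫ w : traceZeroAdele F E c,
        f (y⁻¹ * (γ₀ * (((heisElt hc 0 w : unipotentInBorel F E c 3) : borelAdelic F E c 3) : (quasiSplit F E c 3).Adelic)) * y) ∂μY := by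
  have h := integral_center_unipotent_center_mul hc hcomm μY f 1 w₁ y
  simpa only [OneMemClass.coe_one, one_mul] using h

end CentreIntegrand

/-! ## §2 `E ≃ B_{γ₀}(F)\B(F)` along `ξ ↦ [u(ξ)]` -/

section CosetEquiv

/-- The rational Heisenberg element `u(ξ) = u(ξ, 0)`, `ξ ∈ E`, lies in `G(F)`. [cite: Rogawski1990, §1.10] -/
theorem coe_heisChart_algebraMap_zero_mem_arithmeticSubgroup (hc : c * c = 1) (ξ : E) :
    ((heisChart hc (algebraMap E (AdeleRing (𝓞 E) E) ξ, (0 : traceZeroAdele F E c)) : adelicUnipotent F E c 3) :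
        (quasiSplit F E c 3).Adelic) ∈ (quasiSplit F E c 3).arithmeticSubgroup := by
  have h := heisChart_algebraMap_mem_rationalUnipotent (F := F) hc ξ (0 : rationalTraceZero F E c)
  rw [ZeroMemClass.coe_zero] at h
  obtain ⟨γ, hγ⟩ := (mem_rationalUnipotent_iff _).1 h
  exact ⟨γ, hγ⟩

/-- `u(ξ)` as an element of `B(F) ≤ G(F)`. [cite: Rogawski1990, §1.10] -/
theorem heisChart_algebraMap_zero_mem_arithmeticBorel (hc : c * c = 1) (ξ : E) :
    (⟨((heisChart hc (algebraMap E (AdeleRing (𝓞 E) E) ξ, (0 : traceZeroAdele F E c)) : adelicUnipotent F E c 3) :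
        (quasiSplit F E c 3).Adelic), coe_heisChart_algebraMap_zero_mem_arithmeticSubgroup hc ξ⟩ :
        (quasiSplit F E c 3).arithmeticSubgroup) ∈ arithmeticBorel F E c 3 :=
  (mem_arithmeticBorel_iff _).2 (adelicUnipotent_le_borelAdelic (heisChart hc (algebraMap E (AdeleRing (𝓞 E) E) ξ, 0)).2)

/-- **`E ≃ B_{γ₀}(F)\B(F)` ALONG `ξ ↦ B_{γ₀}(F)·u(ξ)`** for the singular base point `γ₀ = ι(d(a,b,a))`, `a ≠ b`
(`B_{γ₀}(F) = B(F) ∩ C(γ₀) = T(F)·Z_N(F)`): injective because a rational unipotent commuting with `γ₀` is central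
(★ `coe_eq_heisChart_coordY_of_mem_unipotent_centralizer`: its `x`-coordinate vanishes), surjective by the rational Levi
decomposition `b = t·u(ξ, w) = (t·n(w)')·u(ξ)`-type factorisation (★ `exists_equiv_arithmeticBorel_prod`, ★
`exists_equiv_rationalUnipotent_prod`, ★ `torusInBorel_comm`, ★ `basePoint_mul_center_comm`). The representative of the
class of `ξ` is `λ · u(ξ)` with `λ ∈ B_{γ₀}(F)`. [cite: Rogawski1990, §7.2 Prop. 7.2.1 (pp. 91–92)] -/
theorem exists_equiv_borelCentralizerQuotient (hc : c * c = 1) {a b : Eˣ} (hab : (a : E) ≠ (b : E))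
    {g₀ : (quasiSplit F E c 3).Rational} {γ₀ : (quasiSplit F E c 3).arithmeticSubgroup}
    (hg₀ : ((g₀.val : GL (Fin 3) E) : Matrix (Fin 3) (Fin 3) E) = !![(a : E), 0, 0; 0, b, 0; 0, 0, a])
    (hγ₀ : (γ₀ : (quasiSplit F E c 3).Adelic) = (quasiSplit F E c 3).toAdelic g₀) :
    ∃ e : E ≃ Quotient (QuotientGroup.rightRel ((arithmeticBorel F E c 3 ⊓
        Subgroup.centralizer ({γ₀} : Set (quasiSplit F E c 3).arithmeticSubgroup)).subgroupOf (arithmeticBorel F E c 3))),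
      ∀ ξ : E, ∃ l : (quasiSplit F E c 3).arithmeticSubgroup,
        l ∈ arithmeticBorel F E c 3 ⊓ Subgroup.centralizer ({γ₀} : Set (quasiSplit F E c 3).arithmeticSubgroup) ∧
        ((((e ξ).out : arithmeticBorel F E c 3) : (quasiSplit F E c 3).arithmeticSubgroup) : (quasiSplit F E c 3).Adelic) =
          (l : (quasiSplit F E c 3).Adelic) *
            (((heisChart hc (algebraMap E (AdeleRing (𝓞 E) E) ξ, (0 : traceZeroAdele F E c))) : adelicUnipotent F E c 3) :
              (quasiSplit F E c 3).Adelic) := by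
  -- letters
  set Λ₂ : Subgroup (quasiSplit F E c 3).arithmeticSubgroup := arithmeticBorel F E c 3 with hΛ₂
  set Λ : Subgroup (quasiSplit F E c 3).arithmeticSubgroup := arithmeticBorel F E c 3 ⊓
    Subgroup.centralizer ({γ₀} : Set (quasiSplit F E c 3).arithmeticSubgroup) with hΛ
  set uΓ : E → Λ₂ := fun ξ => ⟨⟨((heisChart hc (algebraMap E (AdeleRing (𝓞 E) E) ξ, (0 : traceZeroAdele F E c)) :
      adelicUnipotent F E c 3) : (quasiSplit F E c 3).Adelic), coe_heisChart_algebraMap_zero_mem_arithmeticSubgroup hc ξ⟩,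
    heisChart_algebraMap_zero_mem_arithmeticBorel hc ξ⟩ with huΓ
  have hγ₀T : (γ₀ : (quasiSplit F E c 3).Adelic) ∈ torusAdelic F E c 3 := coe_mem_torusAdelic_of_eq_diag hg₀ hγ₀
  have hcommZ : ∀ w : traceZeroAdele F E c, (γ₀ : (quasiSplit F E c 3).Adelic) *
      (((heisElt hc 0 w : unipotentInBorel F E c 3) : borelAdelic F E c 3) : (quasiSplit F E c 3).Adelic) =
      (((heisElt hc 0 w : unipotentInBorel F E c 3) : borelAdelic F E c 3) : (quasiSplit F E c 3).Adelic) * (γ₀ : (quasiSplit F E c 3).Adelic) :=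
    fun w => basePoint_mul_center_comm hc hg₀ hγ₀ w
  -- membership in `Λ` from an adelic commutation relation
  have hmemΛ : ∀ x : Λ₂, (γ₀ : (quasiSplit F E c 3).Adelic) * ((x : (quasiSplit F E c 3).arithmeticSubgroup) : (quasiSplit F E c 3).Adelic) =
      ((x : (quasiSplit F E c 3).arithmeticSubgroup) : (quasiSplit F E c 3).Adelic) * (γ₀ : (quasiSplit F E c 3).Adelic) →
      x ∈ Λ.subgroupOf Λ₂ := by
    intro x hx
    rw [Subgroup.mem_subgroupOf, hΛ, Subgroup.mem_inf]
    refine ⟨x.2, Subgroup.mem_centralizer_singleton_iff.2 (Subtype.ext ?_)⟩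
    simp only [Subgroup.coe_mul]
    exact hx.symm
  set φ : E → Quotient (QuotientGroup.rightRel (Λ.subgroupOf Λ₂)) := fun ξ =>
    Quotient.mk (QuotientGroup.rightRel (Λ.subgroupOf Λ₂)) (uΓ ξ) with hφ
  -- injectivity
  have hinj : Function.Injective φ := by
    intro ξ ξ' h
    have hrel : @Setoid.r _ (QuotientGroup.rightRel (Λ.subgroupOf Λ₂)) (uΓ ξ) (uΓ ξ') := Quotient.exact h
    rw [QuotientGroup.rightRel_apply, Subgroup.mem_subgroupOf] at hrel
    -- `n := u(ξ') u(ξ)⁻¹ ∈ N♭ ⊓ C(γ₀)`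
    have hn : ((uΓ ξ' * (uΓ ξ)⁻¹ : Λ₂) : (quasiSplit F E c 3).arithmeticSubgroup) ∈
        (adelicUnipotent F E c 3).subgroupOf (quasiSplit F E c 3).arithmeticSubgroup ⊓
          Subgroup.centralizer ({γ₀} : Set (quasiSplit F E c 3).arithmeticSubgroup) := by
      refine Subgroup.mem_inf.2 ⟨Subgroup.mem_subgroupOf.2 ?_, (Subgroup.mem_inf.1 hrel).2⟩
      change ((heisChart hc (algebraMap E (AdeleRing (𝓞 E) E) ξ', (0 : traceZeroAdele F E c)) : adelicUnipotent F E c 3) :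
          (quasiSplit F E c 3).Adelic) *
        (((heisChart hc (algebraMap E (AdeleRing (𝓞 E) E) ξ, (0 : traceZeroAdele F E c)) : adelicUnipotent F E c 3) :
          (quasiSplit F E c 3).Adelic))⁻¹ ∈ adelicUnipotent F E c 3
      exact Subgroup.mul_mem _ (SetLike.coe_mem _) (Subgroup.inv_mem _ (SetLike.coe_mem _))
    have hx0 := (coe_eq_heisChart_coordY_of_mem_unipotent_centralizer hc hab hg₀ hγ₀ hn).2.1
    have hval : (⟨(((uΓ ξ' * (uΓ ξ)⁻¹ : Λ₂) : (quasiSplit F E c 3).arithmeticSubgroup) : (quasiSplit F E c 3).Adelic),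
        Subgroup.mem_subgroupOf.1 (Subgroup.mem_inf.1 hn).1⟩ : adelicUnipotent F E c 3) =
        heisChart hc (algebraMap E (AdeleRing (𝓞 E) E) ξ', (0 : traceZeroAdele F E c)) *
          (heisChart hc (algebraMap E (AdeleRing (𝓞 E) E) ξ, (0 : traceZeroAdele F E c)))⁻¹ := Subtype.ext rfl
    rw [hval, coordX_mul, coordX_inv, coordX_heisChart, coordX_heisChart] at hx0
    have h' : algebraMap E (AdeleRing (𝓞 E) E) (ξ' - ξ) = 0 := by rw [map_sub]; rw [← sub_eq_add_neg] at hx0; exact hx0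
    haveI : Nontrivial (AdeleRing (𝓞 E) E) :=
      inferInstanceAs (Nontrivial (InfiniteAdeleRing E × FiniteAdeleRing (𝓞 E) E))
    have hinjA : Function.Injective (algebraMap E (AdeleRing (𝓞 E) E)) := (algebraMap E (AdeleRing (𝓞 E) E)).injective
    have : ξ' - ξ = 0 := hinjA (by rw [h', map_zero])
    exact (sub_eq_zero.1 this).symm
  -- surjectivity
  have hsurj : Function.Surjective φ := by
    intro η
    obtain ⟨eB, heB⟩ := exists_equiv_arithmeticBorel_prod (F := F) (E := E) (c := c) (N := 3)
    obtain ⟨eN, heN, -⟩ := exists_equiv_rationalUnipotent_prod (F := F) (E := E) (c := c) hc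
    set bη : Λ₂ := η.out with hbη
    set t : rationalTorus F E c 3 := (eB bη).1 with ht
    set m : rationalUnipotent F E c 3 := (eB bη).2 with hm
    set ξ : E := (eN m).1 with hξ
    set w : rationalTraceZero F E c := (eN m).2 with hw
    refine ⟨ξ, ?_⟩
    -- `bη = t · m`, `m = u(ξ, w) = u(ξ) n(w)`
    have hb : ((bη : (quasiSplit F E c 3).arithmeticSubgroup) : (quasiSplit F E c 3).Adelic) =
        ((t : torusAdelic F E c 3) : (quasiSplit F E c 3).Adelic) * ((m : adelicUnipotent F E c 3) : (quasiSplit F E c 3).Adelic) := by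
      have h := heB (eB bη)
      rw [Equiv.symm_apply_apply] at h
      exact h
    have hmval : ((m : adelicUnipotent F E c 3) : (quasiSplit F E c 3).Adelic) =
        ((heisChart hc (algebraMap E (AdeleRing (𝓞 E) E) ξ, (0 : traceZeroAdele F E c)) : adelicUnipotent F E c 3) :
            (quasiSplit F E c 3).Adelic) *
          (((heisElt hc 0 (w : traceZeroAdele F E c) : unipotentInBorel F E c 3) : borelAdelic F E c 3) : (quasiSplit F E c 3).Adelic) := by
      rw [heN m, coe_heisChart, coe_heisChart]
      exact coe_heisElt_eq_heisElt_zero_mul_center hc _ _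
    -- `bη · u(ξ)⁻¹ = t · n(w)` commutes with `γ₀`
    have hprod : ((bη * (uΓ ξ)⁻¹ : Λ₂) : (quasiSplit F E c 3).arithmeticSubgroup) =
        (((bη : Λ₂) : (quasiSplit F E c 3).arithmeticSubgroup)) * ((uΓ ξ : Λ₂) : (quasiSplit F E c 3).arithmeticSubgroup)⁻¹ := rfl
    have hval : (((bη * (uΓ ξ)⁻¹ : Λ₂) : (quasiSplit F E c 3).arithmeticSubgroup) : (quasiSplit F E c 3).Adelic) =
        ((t : torusAdelic F E c 3) : (quasiSplit F E c 3).Adelic) *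
          (((heisElt hc 0 (w : traceZeroAdele F E c) : unipotentInBorel F E c 3) : borelAdelic F E c 3) : (quasiSplit F E c 3).Adelic) := by
      rw [hprod, Subgroup.coe_mul, Subgroup.coe_inv, hb, hmval]
      change _ * (((heisChart hc (algebraMap E (AdeleRing (𝓞 E) E) ξ, (0 : traceZeroAdele F E c)) : adelicUnipotent F E c 3) :
            (quasiSplit F E c 3).Adelic))⁻¹ = _
      have hcz := (commute_center_coe_unipotentInBorel hc (w : traceZeroAdele F E c)
        (heisElt hc (algebraMap E (AdeleRing (𝓞 E) E) ξ) 0)).eq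
      rw [coe_heisChart]
      change (t : (quasiSplit F E c 3).Adelic) * ((((heisElt hc (algebraMap E (AdeleRing (𝓞 E) E) ξ) 0 : unipotentInBorel F E c 3) :
          borelAdelic F E c 3) : (quasiSplit F E c 3).Adelic) * _) * _ = _
      rw [← hcz, mul_assoc, mul_assoc, mul_inv_cancel, mul_one]
    have hcomm : (γ₀ : (quasiSplit F E c 3).Adelic) * (((bη * (uΓ ξ)⁻¹ : Λ₂) : (quasiSplit F E c 3).arithmeticSubgroup) : (quasiSplit F E c 3).Adelic) =
        (((bη * (uΓ ξ)⁻¹ : Λ₂) : (quasiSplit F E c 3).arithmeticSubgroup) : (quasiSplit F E c 3).Adelic) * (γ₀ : (quasiSplit F E c 3).Adelic) := by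
      rw [hval]
      have htt : (γ₀ : (quasiSplit F E c 3).Adelic) * ((t : torusAdelic F E c 3) : (quasiSplit F E c 3).Adelic) =
          ((t : torusAdelic F E c 3) : (quasiSplit F E c 3).Adelic) * (γ₀ : (quasiSplit F E c 3).Adelic) := by
        have h := torusInBorel_comm (⟨⟨(γ₀ : (quasiSplit F E c 3).Adelic), torusAdelic_le_borelAdelic hγ₀T⟩,
            (mem_torusInBorel_iff _).2 hγ₀T⟩ : torusInBorel F E c 3)
          ⟨⟨((t : torusAdelic F E c 3) : (quasiSplit F E c 3).Adelic), torusAdelic_le_borelAdelic (t : torusAdelic F E c 3).2⟩,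
            (mem_torusInBorel_iff _).2 (t : torusAdelic F E c 3).2⟩
        exact congrArg (fun s : torusInBorel F E c 3 => ((s : borelAdelic F E c 3) : (quasiSplit F E c 3).Adelic)) h
      rw [← mul_assoc, htt, mul_assoc, hcommZ, mul_assoc]
    have hmem : bη * (uΓ ξ)⁻¹ ∈ Λ.subgroupOf Λ₂ := hmemΛ _ hcomm
    -- hence `φ ξ = η`
    change Quotient.mk (QuotientGroup.rightRel (Λ.subgroupOf Λ₂)) (uΓ ξ) = η
    rw [← Quotient.out_eq η]
    exact Quotient.sound (QuotientGroup.rightRel_apply.2 (by rw [← hbη]; exact hmem))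
  refine ⟨Equiv.ofBijective φ ⟨hinj, hsurj⟩, fun ξ => ?_⟩
  -- the representative: `(φ ξ).out = λ · u(ξ)` with `λ ∈ Λ`
  have hmem : (Quotient.mk (QuotientGroup.rightRel (Λ.subgroupOf Λ₂)) (uΓ ξ)).out * (uΓ ξ)⁻¹ ∈ Λ.subgroupOf Λ₂ := by
    have h : @Setoid.r _ (QuotientGroup.rightRel (Λ.subgroupOf Λ₂)) (uΓ ξ)
        (Quotient.mk (QuotientGroup.rightRel (Λ.subgroupOf Λ₂)) (uΓ ξ)).out :=
      Quotient.exact (by rw [Quotient.out_eq])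
    exact QuotientGroup.rightRel_apply.1 h
  rw [Subgroup.mem_subgroupOf] at hmem
  refine ⟨(((Quotient.mk (QuotientGroup.rightRel (Λ.subgroupOf Λ₂)) (uΓ ξ)).out * (uΓ ξ)⁻¹ : Λ₂) :
      (quasiSplit F E c 3).arithmeticSubgroup), hmem, ?_⟩
  change ((((Quotient.mk (QuotientGroup.rightRel (Λ.subgroupOf Λ₂)) (uΓ ξ)).out : Λ₂) :
      (quasiSplit F E c 3).arithmeticSubgroup) : (quasiSplit F E c 3).Adelic) = _
  rw [Subgroup.coe_mul, Subgroup.coe_inv, Subgroup.coe_mul, Subgroup.coe_inv]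
  change _ = _ * ((((uΓ ξ : Λ₂) : (quasiSplit F E c 3).arithmeticSubgroup)) : (quasiSplit F E c 3).Adelic)
  rw [inv_mul_cancel_right]

end CosetEquiv


/-! ## §3 The `B_γ(F)\\B(F)`-periodised centre integral `P₀(z) = Σ_{ξ ∈ E} 𝒯(u(ξ) z)` -/

section Periodised

variable [MeasurableSpace (AdeleRing (𝓞 E) E)] [BorelSpace (AdeleRing (𝓞 E) E)]

/-- **`Σ'_{η ∈ B_γ(F)\\B(F)} 𝒯(η̃ z) = Σ'_{ξ ∈ E} 𝒯(u(ξ) z)`** (re-indexing along `exists_equiv_borelCentralizerQuotient`; the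
representative `λ·u(ξ)`, `λ ∈ B_γ(F)`, is absorbed by ★ `integral_center_borelCentralizer_mul`), for every function of the
centre integral: stated for `𝒯` and for `‖𝒯‖ₑ` at once through an arbitrary `Φ ∘ 𝒯`. [cite: Rogawski1990, §7.2 (7.2.3) p. 93] -/
theorem tsum_borelCentralizerQuotient_center_eq_tsum (hc : c * c = 1) (hc1 : c ≠ 1) {a b : Eˣ} {g₀ : (quasiSplit F E c 3).Rational} {γ₀ : (quasiSplit F E c 3).arithmeticSubgroup}
    (hg₀ : ((g₀.val : GL (Fin 3) E) : Matrix (Fin 3) (Fin 3) E) = !![(a : E), 0, 0; 0, b, 0; 0, 0, a])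
    (hγ₀ : (γ₀ : (quasiSplit F E c 3).Adelic) = (quasiSplit F E c 3).toAdelic g₀)
    (hab : (a : E) ≠ (b : E)) (μY : Measure (traceZeroAdele F E c)) [μY.IsAddHaarMeasure] [μY.Regular] (f : (quasiSplit F E c 3).Adelic → ℂ) {M : Type*} [AddCommMonoid M] [TopologicalSpace M] (Φ : ℂ → M) (z : (quasiSplit F E c 3).Adelic) :
    ∑' η : Quotient (QuotientGroup.rightRel ((arithmeticBorel F E c 3 ⊓ Subgroup.centralizer ({γ₀} : Set (quasiSplit F E c 3).arithmeticSubgroup)).subgroupOf (arithmeticBorel F E c 3))),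
        Φ ((μY (traceZeroFundamentalDomain F E c)).toReal⁻¹ • ∫ w : traceZeroAdele F E c, f (((((η.out : arithmeticBorel F E c 3) : (quasiSplit F E c 3).arithmeticSubgroup) : (quasiSplit F E c 3).Adelic) * z)⁻¹ * ((γ₀ : (quasiSplit F E c 3).Adelic) * (((heisElt hc 0 w : unipotentInBorel F E c 3) : borelAdelic F E c 3) : (quasiSplit F E c 3).Adelic)) * ((((η.out : arithmeticBorel F E c 3) : (quasiSplit F E c 3).arithmeticSubgroup) : (quasiSplit F E c 3).Adelic) * z)) ∂μY) =
      ∑' ξ : E, Φ ((μY (traceZeroFundamentalDomain F E c)).toReal⁻¹ • ∫ w : traceZeroAdele F E c, f (((((heisElt hc (algebraMap E (AdeleRing (𝓞 E) E) ξ) 0 : unipotentInBorel F E c 3) : borelAdelic F E c 3) : (quasiSplit F E c 3).Adelic) * z)⁻¹ * ((γ₀ : (quasiSplit F E c 3).Adelic) * (((heisElt hc 0 w : unipotentInBorel F E c 3) : borelAdelic F E c 3) : (quasiSplit F E c 3).Adelic)) * ((((heisElt hc (algebraMap E (AdeleRing (𝓞 E) E) ξ) 0 : unipotentInBorel F E c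 3) : borelAdelic F E c 3) : (quasiSplit F E c 3).Adelic) * z)) ∂μY) := by
  obtain ⟨e, he⟩ := exists_equiv_borelCentralizerQuotient hc hab hg₀ hγ₀
  rw [← e.tsum_eq]
  refine tsum_congr fun ξ => ?_
  obtain ⟨l, hl, hout⟩ := he ξ
  have key : ∫ w : traceZeroAdele F E c, f ((((((e ξ).out : arithmeticBorel F E c 3) : (quasiSplit F E c 3).arithmeticSubgroup) :
        (quasiSplit F E c 3).Adelic) * z)⁻¹ * ((γ₀ : (quasiSplit F E c 3).Adelic) *
          (((heisElt hc 0 w : unipotentInBorel F E c 3) : borelAdelic F E c 3) : (quasiSplit F E c 3).Adelic)) *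
        (((((e ξ).out : arithmeticBorel F E c 3) : (quasiSplit F E c 3).arithmeticSubgroup) : (quasiSplit F E c 3).Adelic) * z)) ∂μY =
      ∫ w : traceZeroAdele F E c, f (((((heisElt hc (algebraMap E (AdeleRing (𝓞 E) E) ξ) 0 : unipotentInBorel F E c 3) :
          borelAdelic F E c 3) : (quasiSplit F E c 3).Adelic) * z)⁻¹ * ((γ₀ : (quasiSplit F E c 3).Adelic) *
          (((heisElt hc 0 w : unipotentInBorel F E c 3) : borelAdelic F E c 3) : (quasiSplit F E c 3).Adelic)) *
        ((((heisElt hc (algebraMap E (AdeleRing (𝓞 E) E) ξ) 0 : unipotentInBorel F E c 3) : borelAdelic F E c 3) :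
          (quasiSplit F E c 3).Adelic) * z)) ∂μY := by
    rw [hout, coe_heisChart, mul_assoc ((l : (quasiSplit F E c 3).arithmeticSubgroup) : (quasiSplit F E c 3).Adelic)]
    exact integral_center_borelCentralizer_mul hc hc1 γ₀ μY f hl _
  rw [key]

/-- **`P₀` IS LEFT `B(F)`-INVARIANT**: `Σ'_ξ 𝒯(u(ξ) b z) = Σ'_ξ 𝒯(u(ξ) z)` for `b ∈ B(F)` — right multiplication by `b` permutes
`B_γ(F)\\B(F)` and `𝒯` is left `B_γ(F)`-invariant. [cite: Rogawski1990, §7.2 (7.2.3) p. 93] -/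
theorem tsum_center_heis_rational_borel_mul (hc : c * c = 1) (hc1 : c ≠ 1) {a b : Eˣ} {g₀ : (quasiSplit F E c 3).Rational} {γ₀ : (quasiSplit F E c 3).arithmeticSubgroup}
    (hg₀ : ((g₀.val : GL (Fin 3) E) : Matrix (Fin 3) (Fin 3) E) = !![(a : E), 0, 0; 0, b, 0; 0, 0, a])
    (hγ₀ : (γ₀ : (quasiSplit F E c 3).Adelic) = (quasiSplit F E c 3).toAdelic g₀)
    (hab : (a : E) ≠ (b : E)) (μY : Measure (traceZeroAdele F E c)) [μY.IsAddHaarMeasure] [μY.Regular] (f : (quasiSplit F E c 3).Adelic → ℂ)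
    (β : (quasiSplit F E c 3).arithmeticSubgroup) (hβ : β ∈ arithmeticBorel F E c 3) (z : (quasiSplit F E c 3).Adelic) :
    ∑' ξ : E, (μY (traceZeroFundamentalDomain F E c)).toReal⁻¹ • ∫ w : traceZeroAdele F E c, f (((((heisElt hc (algebraMap E (AdeleRing (𝓞 E) E) ξ) 0 : unipotentInBorel F E c 3) : borelAdelic F E c 3) : (quasiSplit F E c 3).Adelic) * ((β : (quasiSplit F E c 3).Adelic) * z))⁻¹ * ((γ₀ : (quasiSplit F E c 3).Adelic) * (((heisElt hc 0 w : unipotentInBorel F E c 3) : borelAdelic F E c 3) : (quasiSplit F E c 3).Adelic)) * ((((heisElt hc (algebraMap E (AdeleRing (𝓞 E) E) ξ) 0 : unipotentInBorel F E c 3) : borelAdelic F E c 3) : (quasiSplit F E c 3).Adelic) * ((β : (quasiSplit F E c 3).Adelic) * z))) ∂μY =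
      ∑' ξ : E, (μY (traceZeroFundamentalDomain F E c)).toReal⁻¹ • ∫ w : traceZeroAdele F E c, f (((((heisElt hc (algebraMap E (AdeleRing (𝓞 E) E) ξ) 0 : unipotentInBorel F E c 3) : borelAdelic F E c 3) : (quasiSplit F E c 3).Adelic) * z)⁻¹ * ((γ₀ : (quasiSplit F E c 3).Adelic) * (((heisElt hc 0 w : unipotentInBorel F E c 3) : borelAdelic F E c 3) : (quasiSplit F E c 3).Adelic)) * ((((heisElt hc (algebraMap E (AdeleRing (𝓞 E) E) ξ) 0 : unipotentInBorel F E c 3) : borelAdelic F E c 3) : (quasiSplit F E c 3).Adelic) * z)) ∂μY := by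
  have h1 := tsum_borelCentralizerQuotient_center_eq_tsum hc hc1 hg₀ hγ₀ hab μY f id
    ((β : (quasiSplit F E c 3).Adelic) * z)
  have h2 := tsum_borelCentralizerQuotient_center_eq_tsum hc hc1 hg₀ hγ₀ hab μY f id z
  simp only [id] at h1 h2
  rw [← h1, ← h2]
  -- right multiplication by `β` on `B_γ(F)\B(F)`
  set Λ₂ : Subgroup (quasiSplit F E c 3).arithmeticSubgroup := arithmeticBorel F E c 3 with hΛ₂
  set Λ : Subgroup (quasiSplit F E c 3).arithmeticSubgroup := (arithmeticBorel F E c 3 ⊓ Subgroup.centralizer ({γ₀} : Set (quasiSplit F E c 3).arithmeticSubgroup)) with hΛ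
  set bβ : Λ₂ := ⟨β, hβ⟩ with hbβ
  have hcompat : ∀ (x₀ : Λ₂) (x y : Λ₂), @Setoid.r _ (QuotientGroup.rightRel (Λ.subgroupOf Λ₂)) x y →
      @Setoid.r _ (QuotientGroup.rightRel (Λ.subgroupOf Λ₂)) (x * x₀) (y * x₀) := by
    intro x₀ x y h
    rw [QuotientGroup.rightRel_apply] at h ⊢
    rwa [mul_inv_rev, ← mul_assoc, mul_assoc y, mul_inv_cancel, mul_one]
  set ρ : Quotient (QuotientGroup.rightRel ((arithmeticBorel F E c 3 ⊓ Subgroup.centralizer ({γ₀} : Set (quasiSplit F E c 3).arithmeticSubgroup)).subgroupOf (arithmeticBorel F E c 3))) → Quotient (QuotientGroup.rightRel ((arithmeticBorel F E c 3 ⊓ Subgroup.centralizer ({γ₀} : Set (quasiSplit F E c 3).arithmeticSubgroup)).subgroupOf (arithmeticBorel F E c 3))) := Quotient.map' (· * bβ) (hcompat bβ) with hρ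
  set ρ' : Quotient (QuotientGroup.rightRel ((arithmeticBorel F E c 3 ⊓ Subgroup.centralizer ({γ₀} : Set (quasiSplit F E c 3).arithmeticSubgroup)).subgroupOf (arithmeticBorel F E c 3))) → Quotient (QuotientGroup.rightRel ((arithmeticBorel F E c 3 ⊓ Subgroup.centralizer ({γ₀} : Set (quasiSplit F E c 3).arithmeticSubgroup)).subgroupOf (arithmeticBorel F E c 3))) := Quotient.map' (· * bβ⁻¹) (hcompat bβ⁻¹) with hρ'
  have hρρ' : Function.LeftInverse ρ' ρ := fun q => Quotient.inductionOn' q fun x => by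
    change Quotient.mk'' (x * bβ * bβ⁻¹) = Quotient.mk'' x
    rw [mul_inv_cancel_right]
  have hρ'ρ : Function.RightInverse ρ' ρ := fun q => Quotient.inductionOn' q fun x => by
    change Quotient.mk'' (x * bβ⁻¹ * bβ) = Quotient.mk'' x
    rw [inv_mul_cancel_right]
  set eρ : Quotient (QuotientGroup.rightRel ((arithmeticBorel F E c 3 ⊓ Subgroup.centralizer ({γ₀} : Set (quasiSplit F E c 3).arithmeticSubgroup)).subgroupOf (arithmeticBorel F E c 3))) ≃ Quotient (QuotientGroup.rightRel ((arithmeticBorel F E c 3 ⊓ Subgroup.centralizer ({γ₀} : Set (quasiSplit F E c 3).arithmeticSubgroup)).subgroupOf (arithmeticBorel F E c 3))) := ⟨ρ, ρ', hρρ', hρ'ρ⟩ with heρ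
  conv_rhs => rw [← eρ.tsum_eq]
  refine tsum_congr fun η => ?_
  -- `(ρ η).out = λ · η.out · β` with `λ ∈ Λ`
  have hrel : (ρ η).out * (η.out * bβ)⁻¹ ∈ Λ.subgroupOf Λ₂ := by
    have h1 : ρ η = Quotient.mk (QuotientGroup.rightRel (Λ.subgroupOf Λ₂)) (η.out * bβ) := by
      conv_lhs => rw [← Quotient.out_eq η]
      rfl
    have h : @Setoid.r _ (QuotientGroup.rightRel (Λ.subgroupOf Λ₂)) (η.out * bβ) (ρ η).out :=
      Quotient.exact (by rw [Quotient.out_eq, h1])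
    exact QuotientGroup.rightRel_apply.1 h
  rw [Subgroup.mem_subgroupOf] at hrel
  have hout' : ((((eρ η).out : Λ₂) : (quasiSplit F E c 3).arithmeticSubgroup) : (quasiSplit F E c 3).Adelic) * z =
      ((((ρ η).out * (η.out * bβ)⁻¹ : Λ₂) : (quasiSplit F E c 3).arithmeticSubgroup) : (quasiSplit F E c 3).Adelic) * ((((η.out : Λ₂) : (quasiSplit F E c 3).arithmeticSubgroup) : (quasiSplit F E c 3).Adelic) * ((β : (quasiSplit F E c 3).Adelic) * z)) := by
    simp only [Subgroup.coe_mul, Subgroup.coe_inv]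
    change ((((ρ η).out : Λ₂) : (quasiSplit F E c 3).arithmeticSubgroup) : (quasiSplit F E c 3).Adelic) * z = _
    rw [show (((bβ : Λ₂) : (quasiSplit F E c 3).arithmeticSubgroup) : (quasiSplit F E c 3).Adelic) =
      (β : (quasiSplit F E c 3).Adelic) from rfl]
    group
  rw [hout', integral_center_borelCentralizer_mul hc hc1 γ₀ μY f hrel]

end Periodised


/-! ## §4 The singular Borel defect `𝓔 = K_{B,i♭}(z,z) − Σ'_ξ 𝒯(u(ξ) z)`: invariance, measurability, finite support -/

section Defect

variable [MeasurableSpace (AdeleRing (𝓞 E) E)] [BorelSpace (AdeleRing (𝓞 E) E)]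
  [MeasurableSpace (adelicUnipotent F E c 3)] [BorelSpace (adelicUnipotent F E c 3)]

/-- **THE SINGULAR BOREL DEFECT `𝓔(z) := K_{B,i♭}(z, z) − Σ'_{ξ ∈ E} 𝒯(u(ξ) z)` IS LEFT `B(F)`-INVARIANT** (★
`kernelBorelClass_diag_rational_borel_mul` for the class Borel kernel; `tsum_center_heis_rational_borel_mul` for the periodised
centre integral). [cite: Rogawski1990, §7.2 (7.2.2)–(7.2.3) pp. 92–93] -/
theorem singularDefect_rational_borel_mul (hc : c * c = 1) (hc1 : c ≠ 1) {a b : Eˣ} {g₀ : (quasiSplit F E c 3).Rational} {γ₀ : (quasiSplit F E c 3).arithmeticSubgroup}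
    (hg₀ : ((g₀.val : GL (Fin 3) E) : Matrix (Fin 3) (Fin 3) E) = !![(a : E), 0, 0; 0, b, 0; 0, 0, a])
    (hγ₀ : (γ₀ : (quasiSplit F E c 3).Adelic) = (quasiSplit F E c 3).toAdelic g₀)
    (hab : (a : E) ≠ (b : E)) (ν : Measure (adelicUnipotent F E c 3)) [ν.IsHaarMeasure]
    {𝓕 : Set (adelicUnipotent F E c 3)} (h𝓕 : IsFundamentalDomain (rationalUnipotent F E c 3) 𝓕 ν)
    (μY : Measure (traceZeroAdele F E c)) [μY.IsAddHaarMeasure] [μY.Regular] (f : (quasiSplit F E c 3).Adelic → ℂ)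
    (β : (quasiSplit F E c 3).arithmeticSubgroup) (hβ : β ∈ arithmeticBorel F E c 3) (z : (quasiSplit F E c 3).Adelic) :
    (fun z : (quasiSplit F E c 3).Adelic => kernelBorelClass ν 𝓕 (fun γ : (quasiSplit F E c 3).arithmeticSubgroup => (((adelicVal F E c 3 _ (γ : (quasiSplit F E c 3).Adelic) :
          GL (Fin 3) (AdeleRing (𝓞 E) E)) : Matrix (Fin 3) (Fin 3) (AdeleRing (𝓞 E) E)).charpoly,
        decide (∃ δ : (quasiSplit F E c 3).arithmeticSubgroup, δ * γ * δ⁻¹ ∈ arithmeticBorel F E c 3))) ((Polynomial.map (algebraMap E (AdeleRing (𝓞 E) E)) ((X - C (a : E)) ^ 2 * (X - C (b : E)))), true) f (z) (z) -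
        ∑' ξ : E, (μY (traceZeroFundamentalDomain F E c)).toReal⁻¹ • ∫ w : traceZeroAdele F E c, f (((((heisElt hc (algebraMap E (AdeleRing (𝓞 E) E) ξ) 0 : unipotentInBorel F E c 3) : borelAdelic F E c 3) : (quasiSplit F E c 3).Adelic) * z)⁻¹ * ((γ₀ : (quasiSplit F E c 3).Adelic) * (((heisElt hc 0 w : unipotentInBorel F E c 3) : borelAdelic F E c 3) : (quasiSplit F E c 3).Adelic)) * ((((heisElt hc (algebraMap E (AdeleRing (𝓞 E) E) ξ) 0 : unipotentInBorel F E c 3) : borelAdelic F E c 3) : (quasiSplit F E c 3).Adelic) * z)) ∂μY) ((β : (quasiSplit F E c 3).Adelic) * z) =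
      (fun z : (quasiSplit F E c 3).Adelic => kernelBorelClass ν 𝓕 (fun γ : (quasiSplit F E c 3).arithmeticSubgroup => (((adelicVal F E c 3 _ (γ : (quasiSplit F E c 3).Adelic) :
          GL (Fin 3) (AdeleRing (𝓞 E) E)) : Matrix (Fin 3) (Fin 3) (AdeleRing (𝓞 E) E)).charpoly,
        decide (∃ δ : (quasiSplit F E c 3).arithmeticSubgroup, δ * γ * δ⁻¹ ∈ arithmeticBorel F E c 3))) ((Polynomial.map (algebraMap E (AdeleRing (𝓞 E) E)) ((X - C (a : E)) ^ 2 * (X - C (b : E)))), true) f (z) (z) -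
        ∑' ξ : E, (μY (traceZeroFundamentalDomain F E c)).toReal⁻¹ • ∫ w : traceZeroAdele F E c, f (((((heisElt hc (algebraMap E (AdeleRing (𝓞 E) E) ξ) 0 : unipotentInBorel F E c 3) : borelAdelic F E c 3) : (quasiSplit F E c 3).Adelic) * z)⁻¹ * ((γ₀ : (quasiSplit F E c 3).Adelic) * (((heisElt hc 0 w : unipotentInBorel F E c 3) : borelAdelic F E c 3) : (quasiSplit F E c 3).Adelic)) * ((((heisElt hc (algebraMap E (AdeleRing (𝓞 E) E) ξ) 0 : unipotentInBorel F E c 3) : borelAdelic F E c 3) : (quasiSplit F E c 3).Adelic) * z)) ∂μY) z := by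
  have hcl := isConjInvariant_borelRefine (isConjInvariant_charpoly_adelicVal (F := F) (E := E) (c := c) (N := 3))
  have hclN := isUnipotentInvariantOnBorel_borelRefine (isUnipotentInvariantOnBorel_charpoly_adelicVal (F := F) (E := E) (c := c) (N := 3))
  simp only []
  rw [kernelBorelClass_diag_rational_borel_mul hcl hclN ν h𝓕 _ f β hβ z,
    tsum_center_heis_rational_borel_mul hc hc1 hg₀ hγ₀ hab μY f β hβ z]

variable [MeasurableSpace (quasiSplit F E c 3).Adelic] [BorelSpace (quasiSplit F E c 3).Adelic]

/-- The singular Borel defect is measurable (★ `measurable_kernelBorelClass_diag`; a countable `tsum` of parametric centre integrals,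
★ `stronglyMeasurable_integral_center`). [cite: Rogawski1990, §7.2 (7.2.3) p. 93] -/
theorem measurable_singularDefect (hc : c * c = 1) {a b : Eˣ} (γ₀ : (quasiSplit F E c 3).arithmeticSubgroup)
    (ν : Measure (adelicUnipotent F E c 3)) [SFinite ν] (𝓕 : Set (adelicUnipotent F E c 3))
    (μY : Measure (traceZeroAdele F E c)) [SFinite μY] {f : (quasiSplit F E c 3).Adelic → ℂ} (hfc : Continuous f) :
    Measurable (fun z : (quasiSplit F E c 3).Adelic => kernelBorelClass ν 𝓕 (fun γ : (quasiSplit F E c 3).arithmeticSubgroup => (((adelicVal F E c 3 _ (γ : (quasiSplit F E c 3).Adelic) :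
          GL (Fin 3) (AdeleRing (𝓞 E) E)) : Matrix (Fin 3) (Fin 3) (AdeleRing (𝓞 E) E)).charpoly,
        decide (∃ δ : (quasiSplit F E c 3).arithmeticSubgroup, δ * γ * δ⁻¹ ∈ arithmeticBorel F E c 3))) ((Polynomial.map (algebraMap E (AdeleRing (𝓞 E) E)) ((X - C (a : E)) ^ 2 * (X - C (b : E)))), true) f (z) (z) -
        ∑' ξ : E, (μY (traceZeroFundamentalDomain F E c)).toReal⁻¹ • ∫ w : traceZeroAdele F E c, f (((((heisElt hc (algebraMap E (AdeleRing (𝓞 E) E) ξ) 0 : unipotentInBorel F E c 3) : borelAdelic F E c 3) : (quasiSplit F E c 3).Adelic) * z)⁻¹ * ((γ₀ : (quasiSplit F E c 3).Adelic) * (((heisElt hc 0 w : unipotentInBorel F E c 3) : borelAdelic F E c 3) : (quasiSplit F E c 3).Adelic)) * ((((heisElt hc (algebraMap E (AdeleRing (𝓞 E) E) ξ) 0 : unipotentInBorel F E c 3) : borelAdelic F E c 3) : (quasiSplit F E c 3).Adelic) * z)) ∂μY) := by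
  haveI : Countable E := NumberField.countable' (K := E)
  refine (measurable_kernelBorelClass_diag hfc ν 𝓕 _ _).sub (Measurable.tsum fun ξ => ?_)
  have h := (stronglyMeasurable_integral_center hc γ₀ μY hfc).measurable.comp
    ((continuous_const.mul continuous_id).measurable :
      Measurable fun z : (quasiSplit F E c 3).Adelic =>
        (((heisElt hc (algebraMap E (AdeleRing (𝓞 E) E) ξ) 0 : unipotentInBorel F E c 3) : borelAdelic F E c 3) :
          (quasiSplit F E c 3).Adelic) * z)
  exact h.const_smul ((μY (traceZeroFundamentalDomain F E c)).toReal⁻¹ : ℝ)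

end Defect


/-! ## §5 Finite support of `ξ ↦ 𝒯(u(ξ) z)` and the `B_γ(F)`-invariance of the cut-off centre integral -/

/-- `(u z)⁻¹ X (u z) = z⁻¹ (u⁻¹ X u) z` (bookkeeping). [folklore] -/
private theorem inv_mul_mul_mul_eq_conj_conj (u X z : (quasiSplit F E c 3).Adelic) : (u * z)⁻¹ * X * (u * z) = z⁻¹ * (u⁻¹ * X * u) * z := by
  group

section Support

variable [MeasurableSpace (AdeleRing (𝓞 E) E)] [BorelSpace (AdeleRing (𝓞 E) E)]

omit [BorelSpace (AdeleRing (𝓞 E) E)] in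
/-- **Only finitely many `ξ ∈ E` have `𝒯(u(ξ) z) ≠ 0`** for `f ∈ C_c(G(𝔸_F))`: the kernel
`(x, w) ↦ f(z⁻¹ (u(x)⁻¹ (γ₀ n(w)) u(x)) z)` has compact support (★ `hasCompactSupport_singularKernel`, ★ `hasCompactSupport_conj`),
and the principal adeles in a compact set are finite (★ `finite_setOf_algebraMap_mem`).
[cite: Rogawski1990, §7.2 Prop. 7.2.1 (pp. 91–92)] -/
theorem finite_support_center_heis (hc : c * c = 1) {a b : Eˣ} {g₀ : (quasiSplit F E c 3).Rational} {γ₀ : (quasiSplit F E c 3).arithmeticSubgroup}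
    (hg₀ : ((g₀.val : GL (Fin 3) E) : Matrix (Fin 3) (Fin 3) E) = !![(a : E), 0, 0; 0, b, 0; 0, 0, a])
    (hγ₀ : (γ₀ : (quasiSplit F E c 3).Adelic) = (quasiSplit F E c 3).toAdelic g₀)
    (hab : (a : E) ≠ (b : E)) (μY : Measure (traceZeroAdele F E c)) {f : (quasiSplit F E c 3).Adelic → ℂ} (hf : HasCompactSupport f)
    (z : (quasiSplit F E c 3).Adelic) :
    (Function.support fun ξ : E => (μY (traceZeroFundamentalDomain F E c)).toReal⁻¹ • ∫ w : traceZeroAdele F E c, f (((((heisElt hc (algebraMap E (AdeleRing (𝓞 E) E) ξ) 0 : unipotentInBorel F E c 3) : borelAdelic F E c 3) : (quasiSplit F E c 3).Adelic) * z)⁻¹ * ((γ₀ : (quasiSplit F E c 3).Adelic) * (((heisElt hc 0 w : unipotentInBorel F E c 3) : borelAdelic F E c 3) : (quasiSplit F E c 3).Adelic)) * ((((heisElt hc (algebraMap E (AdeleRing (𝓞 E) E) ξ) 0 : unipotentInBorel F E c 3) : borelAdelic F E c 3) : (quasiSplit F E c 3).Adelic) * z)) ∂μY).Finite := by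
  haveI := locallyCompactSpace_adeleRing' E
  have hKc := hasCompactSupport_singularKernel hc hab hg₀ hγ₀ (hasCompactSupport_conj hf z)
  refine (finite_setOf_algebraMap_mem E (hKc.isCompact.image continuous_fst)).subset fun ξ hξ => ?_
  -- if `algebraMap ξ ∉ fst '' tsupport`, the integrand vanishes identically in `w`
  by_contra hnot
  apply hξ
  have hzero : ∀ w : traceZeroAdele F E c,
      f (((((heisElt hc (algebraMap E (AdeleRing (𝓞 E) E) ξ) 0 : unipotentInBorel F E c 3) : borelAdelic F E c 3) : (quasiSplit F E c 3).Adelic) * z)⁻¹ * ((γ₀ : (quasiSplit F E c 3).Adelic) * (((heisElt hc 0 w : unipotentInBorel F E c 3) : borelAdelic F E c 3) : (quasiSplit F E c 3).Adelic)) * ((((heisElt hc (algebraMap E (AdeleRing (𝓞 E) E) ξ) 0 : unipotentInBorel F E c 3) : borelAdelic F E c 3) : (quasiSplit F E c 3).Adelic) * z)) = 0 := by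
    intro w
    rw [inv_mul_mul_mul_eq_conj_conj]
    have hnmem : (algebraMap E (AdeleRing (𝓞 E) E) ξ, w) ∉ tsupport (fun p : AdeleRing (𝓞 E) E × traceZeroAdele F E c =>
        (fun g : (quasiSplit F E c 3).Adelic => f (z⁻¹ * g * z))
          ((((heisElt hc p.1 (0 : traceZeroAdele F E c) : unipotentInBorel F E c 3) : borelAdelic F E c 3) : (quasiSplit F E c 3).Adelic)⁻¹ *
            ((γ₀ : (quasiSplit F E c 3).Adelic) * (((heisElt hc 0 p.2 : unipotentInBorel F E c 3) : borelAdelic F E c 3) : (quasiSplit F E c 3).Adelic)) *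
            (((heisElt hc p.1 (0 : traceZeroAdele F E c) : unipotentInBorel F E c 3) : borelAdelic F E c 3) : (quasiSplit F E c 3).Adelic))) :=
      fun hmem => hnot ⟨_, hmem, rfl⟩
    have h0 := image_eq_zero_of_notMem_tsupport hnmem
    simpa only using h0
  change (μY (traceZeroFundamentalDomain F E c)).toReal⁻¹ • (∫ w : traceZeroAdele F E c,
      f (((((heisElt hc (algebraMap E (AdeleRing (𝓞 E) E) ξ) 0 : unipotentInBorel F E c 3) : borelAdelic F E c 3) : (quasiSplit F E c 3).Adelic) * z)⁻¹ * ((γ₀ : (quasiSplit F E c 3).Adelic) * (((heisElt hc 0 w : unipotentInBorel F E c 3) : borelAdelic F E c 3) : (quasiSplit F E c 3).Adelic)) * ((((heisElt hc (algebraMap E (AdeleRing (𝓞 E) E) ξ) 0 : unipotentInBorel F E c 3) : borelAdelic F E c 3) : (quasiSplit F E c 3).Adelic) * z)) ∂μY) = 0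
  simp_rw [hzero]
  rw [integral_zero, smul_zero]

/-- **The cut-off centre integral `1_{T<H} · 𝒯` is left `B_{γ₀}(F)`-invariant** (★ `borelHeight_rational_borel_mul`, ★
`integral_center_borelCentralizer_mul`; the `T`-piece half of ★ `singularBracket_borelCentralizer_mul`).
[cite: Rogawski1990, §7.2 (7.2.3) pp. 92–93] -/
theorem indicator_center_borelCentralizer_mul (hc : c * c = 1) (hc1 : c ≠ 1) (γ₀ : (quasiSplit F E c 3).arithmeticSubgroup) (μY : Measure (traceZeroAdele F E c)) [μY.IsAddHaarMeasure] [μY.Regular]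
    (T : ℝ≥0) (f : (quasiSplit F E c 3).Adelic → ℂ) {β : (quasiSplit F E c 3).arithmeticSubgroup} (hβ : β ∈ (arithmeticBorel F E c 3 ⊓ Subgroup.centralizer ({γ₀} : Set (quasiSplit F E c 3).arithmeticSubgroup))) (y : (quasiSplit F E c 3).Adelic) :
    Set.indicator {y : (quasiSplit F E c 3).Adelic | T < borelHeight y} (fun y : (quasiSplit F E c 3).Adelic => (μY (traceZeroFundamentalDomain F E c)).toReal⁻¹ • ∫ w : traceZeroAdele F E c, f (y⁻¹ * ((γ₀ : (quasiSplit F E c 3).Adelic) * (((heisElt hc 0 w : unipotentInBorel F E c 3) : borelAdelic F E c 3) : (quasiSplit F E c 3).Adelic)) * y) ∂μY) ((β : (quasiSplit F E c 3).Adelic) * y) =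
      Set.indicator {y : (quasiSplit F E c 3).Adelic | T < borelHeight y} (fun y : (quasiSplit F E c 3).Adelic => (μY (traceZeroFundamentalDomain F E c)).toReal⁻¹ • ∫ w : traceZeroAdele F E c, f (y⁻¹ * ((γ₀ : (quasiSplit F E c 3).Adelic) * (((heisElt hc 0 w : unipotentInBorel F E c 3) : borelAdelic F E c 3) : (quasiSplit F E c 3).Adelic)) * y) ∂μY) y := by
  obtain ⟨hβB, -⟩ := Subgroup.mem_inf.1 hβ
  obtain ⟨γ, hγ⟩ := β.2
  have hγB : (quasiSplit F E c 3).toAdelic γ ∈ borelAdelic F E c 3 := by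
    rw [hγ]; exact (mem_arithmeticBorel_iff β).1 hβB
  have hH : borelHeight ((β : (quasiSplit F E c 3).Adelic) * y) = borelHeight y := by
    rw [← hγ]; exact borelHeight_rational_borel_mul γ hγB y
  by_cases hy : T < borelHeight y
  · rw [Set.indicator_of_mem (show (β : (quasiSplit F E c 3).Adelic) * y ∈ {y : (quasiSplit F E c 3).Adelic | T < borelHeight y} by
        change T < borelHeight _; rw [hH]; exact hy),
      Set.indicator_of_mem (show y ∈ {y : (quasiSplit F E c 3).Adelic | T < borelHeight y} from hy),
      integral_center_borelCentralizer_mul hc hc1 γ₀ μY f hβ y]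
  · rw [Set.indicator_of_notMem (show (β : (quasiSplit F E c 3).Adelic) * y ∉ {y : (quasiSplit F E c 3).Adelic | T < borelHeight y} by
        change ¬ T < borelHeight _; rw [hH]; exact hy),
      Set.indicator_of_notMem (show y ∉ {y : (quasiSplit F E c 3).Adelic | T < borelHeight y} from hy)]

end Support



/-! ## §6 The comparison identity: `Σ'_{q ∈ B_γ(F)\\G(F)} b_T(q̃ y) = k^T_{i♭}(y) − S(y) + Σ_{δ∈B(F)\\G(F)}(1_{T<H}𝓔)(δy)` -/

section Comparison

variable [MeasurableSpace (AdeleRing (𝓞 E) E)] [BorelSpace (AdeleRing (𝓞 E) E)]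

omit [MeasurableSpace (AdeleRing (𝓞 E) E)] [BorelSpace (AdeleRing (𝓞 E) E)] in
/-- **The `n`-sums of the bracket regroup to `K_{i♭}(y,y) − S(y)`** over `B_γ(F)\\G(F)` (★ (R2)
`kernelClass_singular_eq_tsum_conjOrbit_add_tsum_tsum`, with its summability through ★ `bijective_singularFibreMap`).
[cite: Rogawski1990, §7.2 Prop. 7.2.1 (pp. 91–92)] -/
theorem summable_and_tsum_nsum_quotient_eq (hc : c * c = 1) {a b : Eˣ} {g₀ : (quasiSplit F E c 3).Rational} {γ₀ : (quasiSplit F E c 3).arithmeticSubgroup}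
    (hg₀ : ((g₀.val : GL (Fin 3) E) : Matrix (Fin 3) (Fin 3) E) = !![(a : E), 0, 0; 0, b, 0; 0, 0, a])
    (hγ₀ : (γ₀ : (quasiSplit F E c 3).Adelic) = (quasiSplit F E c 3).toAdelic g₀)
    (hab : (a : E) ≠ (b : E)) (ha : c (a : E) * (a : E) = 1) (hb : c (b : E) * (b : E) = 1)
    {f : (quasiSplit F E c 3).Adelic → ℂ} (hf : HasCompactSupport f) (y : (quasiSplit F E c 3).Adelic) :
    (Summable fun q : Quotient (QuotientGroup.rightRel (arithmeticBorel F E c 3 ⊓ Subgroup.centralizer ({γ₀} : Set (quasiSplit F E c 3).arithmeticSubgroup))) => (∑' n : {n : ↥((adelicUnipotent F E c 3).subgroupOf (quasiSplit F E c 3).arithmeticSubgroup ⊓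
        Subgroup.centralizer ({γ₀} : Set (quasiSplit F E c 3).arithmeticSubgroup)) // n ≠ 1},
      f ((((q.out : (quasiSplit F E c 3).arithmeticSubgroup) : (quasiSplit F E c 3).Adelic) * y)⁻¹ * (((n.1 : (quasiSplit F E c 3).arithmeticSubgroup) * γ₀ : (quasiSplit F E c 3).arithmeticSubgroup) : (quasiSplit F E c 3).Adelic) * (((q.out : (quasiSplit F E c 3).arithmeticSubgroup) : (quasiSplit F E c 3).Adelic) * y)))) ∧
    ∑' q : Quotient (QuotientGroup.rightRel (arithmeticBorel F E c 3 ⊓ Subgroup.centralizer ({γ₀} : Set (quasiSplit F E c 3).arithmeticSubgroup))), (∑' n : {n : ↥((adelicUnipotent F E c 3).subgroupOf (quasiSplit F E c 3).arithmeticSubgroup ⊓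
        Subgroup.centralizer ({γ₀} : Set (quasiSplit F E c 3).arithmeticSubgroup)) // n ≠ 1},
      f ((((q.out : (quasiSplit F E c 3).arithmeticSubgroup) : (quasiSplit F E c 3).Adelic) * y)⁻¹ * (((n.1 : (quasiSplit F E c 3).arithmeticSubgroup) * γ₀ : (quasiSplit F E c 3).arithmeticSubgroup) : (quasiSplit F E c 3).Adelic) * (((q.out : (quasiSplit F E c 3).arithmeticSubgroup) : (quasiSplit F E c 3).Adelic) * y))) =
      kernelClass (fun γ : (quasiSplit F E c 3).arithmeticSubgroup => (((adelicVal F E c 3 _ (γ : (quasiSplit F E c 3).Adelic) :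
          GL (Fin 3) (AdeleRing (𝓞 E) E)) : Matrix (Fin 3) (Fin 3) (AdeleRing (𝓞 E) E)).charpoly,
        decide (∃ δ : (quasiSplit F E c 3).arithmeticSubgroup, δ * γ * δ⁻¹ ∈ arithmeticBorel F E c 3))) ((Polynomial.map (algebraMap E (AdeleRing (𝓞 E) E)) ((X - C (a : E)) ^ 2 * (X - C (b : E)))), true) f y y - (∑' s : ↥(conjOrbit (quasiSplit F E c 3).arithmeticSubgroup (γ₀ : (quasiSplit F E c 3).Adelic)), f (y⁻¹ * (s : (quasiSplit F E c 3).Adelic) * y)) := by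
  classical
  have hΨ := bijective_singularFibreMap hc hg₀ hγ₀ hab ha hb
  have hi : Function.Injective (fun p : Quotient (QuotientGroup.rightRel (arithmeticBorel F E c 3 ⊓ Subgroup.centralizer ({γ₀} : Set (quasiSplit F E c 3).arithmeticSubgroup))) × {n : ↥((adelicUnipotent F E c 3).subgroupOf (quasiSplit F E c 3).arithmeticSubgroup ⊓
        Subgroup.centralizer ({γ₀} : Set (quasiSplit F E c 3).arithmeticSubgroup)) // n ≠ 1} =>
      (p.1.out⁻¹ * (((p.2 : ↥((adelicUnipotent F E c 3).subgroupOf (quasiSplit F E c 3).arithmeticSubgroup ⊓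
        Subgroup.centralizer ({γ₀} : Set (quasiSplit F E c 3).arithmeticSubgroup))) : (quasiSplit F E c 3).arithmeticSubgroup) * γ₀) * p.1.out : (quasiSplit F E c 3).arithmeticSubgroup)) := fun p p' h =>
    hΨ.1 (Subtype.ext (Subtype.ext h))
  have hsum : Summable fun p : Quotient (QuotientGroup.rightRel (arithmeticBorel F E c 3 ⊓ Subgroup.centralizer ({γ₀} : Set (quasiSplit F E c 3).arithmeticSubgroup))) × {n : ↥((adelicUnipotent F E c 3).subgroupOf (quasiSplit F E c 3).arithmeticSubgroup ⊓
        Subgroup.centralizer ({γ₀} : Set (quasiSplit F E c 3).arithmeticSubgroup)) // n ≠ 1} =>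
      f (y⁻¹ * ((p.1.out⁻¹ * (((p.2 : ↥((adelicUnipotent F E c 3).subgroupOf (quasiSplit F E c 3).arithmeticSubgroup ⊓
        Subgroup.centralizer ({γ₀} : Set (quasiSplit F E c 3).arithmeticSubgroup))) : (quasiSplit F E c 3).arithmeticSubgroup) * γ₀) * p.1.out : (quasiSplit F E c 3).arithmeticSubgroup) : (quasiSplit F E c 3).Adelic) * y) :=
    (summable_kernel_of_hasCompactSupport hf y y).comp_injective hi
  have hterm : ∀ (q : Quotient (QuotientGroup.rightRel (arithmeticBorel F E c 3 ⊓ Subgroup.centralizer ({γ₀} : Set (quasiSplit F E c 3).arithmeticSubgroup)))) (n : {n : ↥((adelicUnipotent F E c 3).subgroupOf (quasiSplit F E c 3).arithmeticSubgroup ⊓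
        Subgroup.centralizer ({γ₀} : Set (quasiSplit F E c 3).arithmeticSubgroup)) // n ≠ 1}),
      f (y⁻¹ * ((q.out⁻¹ * (((n : ↥((adelicUnipotent F E c 3).subgroupOf (quasiSplit F E c 3).arithmeticSubgroup ⊓
        Subgroup.centralizer ({γ₀} : Set (quasiSplit F E c 3).arithmeticSubgroup))) : (quasiSplit F E c 3).arithmeticSubgroup) * γ₀) * q.out : (quasiSplit F E c 3).arithmeticSubgroup) : (quasiSplit F E c 3).Adelic) * y) =
        f ((((q.out : (quasiSplit F E c 3).arithmeticSubgroup) : (quasiSplit F E c 3).Adelic) * y)⁻¹ * (((n.1 : (quasiSplit F E c 3).arithmeticSubgroup) * γ₀ : (quasiSplit F E c 3).arithmeticSubgroup) : (quasiSplit F E c 3).Adelic) * (((q.out : (quasiSplit F E c 3).arithmeticSubgroup) : (quasiSplit F E c 3).Adelic) * y)) := by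
    intro q n
    congr 1
    simp only [Subgroup.coe_mul, Subgroup.coe_inv]
    group
  refine ⟨?_, ?_⟩
  · have h := hsum.prod
    simp only [hterm] at h
    exact h
  · have hK := kernelClass_singular_eq_tsum_conjOrbit_add_tsum_tsum hc hg₀ hγ₀ hab ha hb hf y y
    simp only [hterm] at hK
    rw [hK, add_sub_cancel_left]

omit [MeasurableSpace (AdeleRing (𝓞 E) E)] [BorelSpace (AdeleRing (𝓞 E) E)] in
/-- Height of `η̃ z` for `η ∈ B_γ(F)\\B(F)`: `H(η̃ z) = H(z)` (★ `borelHeight_rational_borel_mul`). [cite: Rogawski1990, §2.2 (p. 13)] -/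
theorem borelHeight_quotientSub_out_mul (γ₀ : (quasiSplit F E c 3).arithmeticSubgroup) (η : Quotient (QuotientGroup.rightRel ((arithmeticBorel F E c 3 ⊓ Subgroup.centralizer ({γ₀} : Set (quasiSplit F E c 3).arithmeticSubgroup)).subgroupOf (arithmeticBorel F E c 3)))) (z : (quasiSplit F E c 3).Adelic) :
    borelHeight ((((η.out : arithmeticBorel F E c 3) : (quasiSplit F E c 3).arithmeticSubgroup) : (quasiSplit F E c 3).Adelic) * z) = borelHeight z := by
  obtain ⟨γ, hγ⟩ := ((η.out : arithmeticBorel F E c 3) : (quasiSplit F E c 3).arithmeticSubgroup).2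
  have hγB : (quasiSplit F E c 3).toAdelic γ ∈ borelAdelic F E c 3 := by
    rw [hγ]; exact (mem_arithmeticBorel_iff _).1 (η.out : arithmeticBorel F E c 3).2
  rw [← hγ]; exact borelHeight_rational_borel_mul γ hγB z

/-- **The inner sums of the two-step regrouping**: `Σ'_{η ∈ B_γ(F)\\B(F)} (1_{T<H}𝒯)(η̃ z) = (1_{T<H} P₀)(z)` with
`P₀(z) = Σ'_ξ 𝒯(u(ξ) z)` (§3). [cite: Rogawski1990, §7.2 (7.2.3) pp. 92–93] -/
theorem tsum_indicator_center_quotientSub_eq (hc : c * c = 1) (hc1 : c ≠ 1) {a b : Eˣ} {g₀ : (quasiSplit F E c 3).Rational} {γ₀ : (quasiSplit F E c 3).arithmeticSubgroup}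
    (hg₀ : ((g₀.val : GL (Fin 3) E) : Matrix (Fin 3) (Fin 3) E) = !![(a : E), 0, 0; 0, b, 0; 0, 0, a])
    (hγ₀ : (γ₀ : (quasiSplit F E c 3).Adelic) = (quasiSplit F E c 3).toAdelic g₀)
    (hab : (a : E) ≠ (b : E)) (μY : Measure (traceZeroAdele F E c)) [μY.IsAddHaarMeasure] [μY.Regular] (f : (quasiSplit F E c 3).Adelic → ℂ) (T : ℝ≥0) (z : (quasiSplit F E c 3).Adelic) :
    ∑' η : Quotient (QuotientGroup.rightRel ((arithmeticBorel F E c 3 ⊓ Subgroup.centralizer ({γ₀} : Set (quasiSplit F E c 3).arithmeticSubgroup)).subgroupOf (arithmeticBorel F E c 3))), {y : (quasiSplit F E c 3).Adelic | T < borelHeight y}.indicator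
        (fun y : (quasiSplit F E c 3).Adelic => (μY (traceZeroFundamentalDomain F E c)).toReal⁻¹ • ∫ w : traceZeroAdele F E c, f (y⁻¹ * ((γ₀ : (quasiSplit F E c 3).Adelic) * (((heisElt hc 0 w : unipotentInBorel F E c 3) : borelAdelic F E c 3) : (quasiSplit F E c 3).Adelic)) * y) ∂μY) ((((η.out : arithmeticBorel F E c 3) : (quasiSplit F E c 3).arithmeticSubgroup) : (quasiSplit F E c 3).Adelic) * z) =
      {y : (quasiSplit F E c 3).Adelic | T < borelHeight y}.indicator (fun z : (quasiSplit F E c 3).Adelic => ∑' ξ : E, (μY (traceZeroFundamentalDomain F E c)).toReal⁻¹ • ∫ w : traceZeroAdele F E c, f (((((heisElt hc (algebraMap E (AdeleRing (𝓞 E) E) ξ) 0 : unipotentInBorel F E c 3) : borelAdelic F E c 3) : (quasiSplit F E c 3).Adelic) * z)⁻¹ * ((γ₀ : (quasiSplit F E c 3).Adelic) * (((heisElt hc 0 w : unipotentInBorel F E c 3) : borelAdelic F E c 3) : (quasiSplit F E c 3).Adelic)) * ((((heisElt hc (algebraMap E (AdeleRing (𝓞 E) E) ξ) 0 : unipotentInBorel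 F E c 3) : borelAdelic F E c 3) : (quasiSplit F E c 3).Adelic) * z)) ∂μY) z := by
  by_cases hz : T < borelHeight z
  · rw [Set.indicator_of_mem (show z ∈ {y : (quasiSplit F E c 3).Adelic | T < borelHeight y} from hz)]
    have hpt : ∀ η : Quotient (QuotientGroup.rightRel ((arithmeticBorel F E c 3 ⊓ Subgroup.centralizer ({γ₀} : Set (quasiSplit F E c 3).arithmeticSubgroup)).subgroupOf (arithmeticBorel F E c 3))), {y : (quasiSplit F E c 3).Adelic | T < borelHeight y}.indicator (fun y : (quasiSplit F E c 3).Adelic => (μY (traceZeroFundamentalDomain F E c)).toReal⁻¹ • ∫ w : traceZeroAdele F E c, f (y⁻¹ * ((γ₀ : (quasiSplit F E c 3).Adelic) * (((heisElt hc 0 w : unipotentInBorel F E c 3) : borelAdelic F E c 3) : (quasiSplit F E c 3).Adelic)) * y) ∂μY) ((((η.out : arithmeticBorel F E c 3) : (quasiSplit F E c 3).arithmeticSubgroup) : (quasiSplit F E c 3).Adelic) * z) =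
        (μY (traceZeroFundamentalDomain F E c)).toReal⁻¹ • ∫ w : traceZeroAdele F E c, f (((((η.out : arithmeticBorel F E c 3) : (quasiSplit F E c 3).arithmeticSubgroup) : (quasiSplit F E c 3).Adelic) * z)⁻¹ * ((γ₀ : (quasiSplit F E c 3).Adelic) * (((heisElt hc 0 w : unipotentInBorel F E c 3) : borelAdelic F E c 3) : (quasiSplit F E c 3).Adelic)) * ((((η.out : arithmeticBorel F E c 3) : (quasiSplit F E c 3).arithmeticSubgroup) : (quasiSplit F E c 3).Adelic) * z)) ∂μY := fun η =>
      Set.indicator_of_mem (show (((η.out : arithmeticBorel F E c 3) : (quasiSplit F E c 3).arithmeticSubgroup) : (quasiSplit F E c 3).Adelic) * z ∈ {y : (quasiSplit F E c 3).Adelic | T < borelHeight y} by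
        change T < borelHeight _; rw [borelHeight_quotientSub_out_mul γ₀]; exact hz) _
    simp only [hpt]
    have h := tsum_borelCentralizerQuotient_center_eq_tsum hc hc1 hg₀ hγ₀ hab μY f id z
    simpa only [id] using h
  · rw [Set.indicator_of_notMem (show z ∉ {y : (quasiSplit F E c 3).Adelic | T < borelHeight y} from hz)]
    have hpt : ∀ η : Quotient (QuotientGroup.rightRel ((arithmeticBorel F E c 3 ⊓ Subgroup.centralizer ({γ₀} : Set (quasiSplit F E c 3).arithmeticSubgroup)).subgroupOf (arithmeticBorel F E c 3))), {y : (quasiSplit F E c 3).Adelic | T < borelHeight y}.indicator (fun y : (quasiSplit F E c 3).Adelic => (μY (traceZeroFundamentalDomain F E c)).toReal⁻¹ • ∫ w : traceZeroAdele F E c, f (y⁻¹ * ((γ₀ : (quasiSplit F E c 3).Adelic) * (((heisElt hc 0 w : unipotentInBorel F E c 3) : borelAdelic F E c 3) : (quasiSplit F E c 3).Adelic)) * y) ∂μY) ((((η.out : arithmeticBorel F E c 3) : (quasiSplit F E c 3).arithmeticSubgroup) : (quasiSplit F E c 3).Adelic) * z) = 0 := fun η =>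
      Set.indicator_of_notMem (show (((η.out : arithmeticBorel F E c 3) : (quasiSplit F E c 3).arithmeticSubgroup) : (quasiSplit F E c 3).Adelic) * z ∉ {y : (quasiSplit F E c 3).Adelic | T < borelHeight y} by
        change ¬ T < borelHeight _; rw [borelHeight_quotientSub_out_mul γ₀]; exact hz) _
    simp only [hpt, tsum_zero]

/-- The `‖·‖ₑ` companion of `tsum_indicator_center_quotientSub_eq`. [cite: Rogawski1990, §7.2 (7.2.3) pp. 92–93] -/
theorem tsum_enorm_indicator_center_quotientSub_eq (hc : c * c = 1) (hc1 : c ≠ 1) {a b : Eˣ} {g₀ : (quasiSplit F E c 3).Rational} {γ₀ : (quasiSplit F E c 3).arithmeticSubgroup}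
    (hg₀ : ((g₀.val : GL (Fin 3) E) : Matrix (Fin 3) (Fin 3) E) = !![(a : E), 0, 0; 0, b, 0; 0, 0, a])
    (hγ₀ : (γ₀ : (quasiSplit F E c 3).Adelic) = (quasiSplit F E c 3).toAdelic g₀)
    (hab : (a : E) ≠ (b : E)) (μY : Measure (traceZeroAdele F E c)) [μY.IsAddHaarMeasure] [μY.Regular] (f : (quasiSplit F E c 3).Adelic → ℂ) (T : ℝ≥0) (z : (quasiSplit F E c 3).Adelic) :
    ∑' η : Quotient (QuotientGroup.rightRel ((arithmeticBorel F E c 3 ⊓ Subgroup.centralizer ({γ₀} : Set (quasiSplit F E c 3).arithmeticSubgroup)).subgroupOf (arithmeticBorel F E c 3))), ‖{y : (quasiSplit F E c 3).Adelic | T < borelHeight y}.indicator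
        (fun y : (quasiSplit F E c 3).Adelic => (μY (traceZeroFundamentalDomain F E c)).toReal⁻¹ • ∫ w : traceZeroAdele F E c, f (y⁻¹ * ((γ₀ : (quasiSplit F E c 3).Adelic) * (((heisElt hc 0 w : unipotentInBorel F E c 3) : borelAdelic F E c 3) : (quasiSplit F E c 3).Adelic)) * y) ∂μY) ((((η.out : arithmeticBorel F E c 3) : (quasiSplit F E c 3).arithmeticSubgroup) : (quasiSplit F E c 3).Adelic) * z)‖ₑ =
      {y : (quasiSplit F E c 3).Adelic | T < borelHeight y}.indicator (fun z : (quasiSplit F E c 3).Adelic => ∑' ξ : E, ‖(μY (traceZeroFundamentalDomain F E c)).toReal⁻¹ • ∫ w : traceZeroAdele F E c, f (((((heisElt hc (algebraMap E (AdeleRing (𝓞 E) E) ξ) 0 : unipotentInBorel F E c 3) : borelAdelic F E c 3) : (quasiSplit F E c 3).Adelic) * z)⁻¹ * ((γ₀ : (quasiSplit F E c 3).Adelic) * (((heisElt hc 0 w : unipotentInBorel F E c 3) : borelAdelic F E c 3) : (quasiSplit F E c 3).Adelic)) * ((((heisElt hc (algebraMap E (AdeleRing (𝓞 E) E) ξ)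 0 : unipotentInBorel F E c 3) : borelAdelic F E c 3) : (quasiSplit F E c 3).Adelic) * z)) ∂μY‖ₑ) z := by
  by_cases hz : T < borelHeight z
  · rw [Set.indicator_of_mem (show z ∈ {y : (quasiSplit F E c 3).Adelic | T < borelHeight y} from hz)]
    have hpt : ∀ η : Quotient (QuotientGroup.rightRel ((arithmeticBorel F E c 3 ⊓ Subgroup.centralizer ({γ₀} : Set (quasiSplit F E c 3).arithmeticSubgroup)).subgroupOf (arithmeticBorel F E c 3))), {y : (quasiSplit F E c 3).Adelic | T < borelHeight y}.indicator (fun y : (quasiSplit F E c 3).Adelic => (μY (traceZeroFundamentalDomain F E c)).toReal⁻¹ • ∫ w : traceZeroAdele F E c, f (y⁻¹ * ((γ₀ : (quasiSplit F E c 3).Adelic) * (((heisElt hc 0 w : unipotentInBorel F E c 3) : borelAdelic F E c 3) : (quasiSplit F E c 3).Adelic)) * y) ∂μY) ((((η.out : arithmeticBorel F E c 3) : (quasiSplit F E c 3).arithmeticSubgroup) : (quasiSplit F E c 3).Adelic) * z) =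
        (μY (traceZeroFundamentalDomain F E c)).toReal⁻¹ • ∫ w : traceZeroAdele F E c, f (((((η.out : arithmeticBorel F E c 3) : (quasiSplit F E c 3).arithmeticSubgroup) : (quasiSplit F E c 3).Adelic) * z)⁻¹ * ((γ₀ : (quasiSplit F E c 3).Adelic) * (((heisElt hc 0 w : unipotentInBorel F E c 3) : borelAdelic F E c 3) : (quasiSplit F E c 3).Adelic)) * ((((η.out : arithmeticBorel F E c 3) : (quasiSplit F E c 3).arithmeticSubgroup) : (quasiSplit F E c 3).Adelic) * z)) ∂μY := fun η =>
      Set.indicator_of_mem (show (((η.out : arithmeticBorel F E c 3) : (quasiSplit F E c 3).arithmeticSubgroup) : (quasiSplit F E c 3).Adelic) * z ∈ {y : (quasiSplit F E c 3).Adelic | T < borelHeight y} by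
        change T < borelHeight _; rw [borelHeight_quotientSub_out_mul γ₀]; exact hz) _
    simp only [hpt]
    exact tsum_borelCentralizerQuotient_center_eq_tsum hc hc1 hg₀ hγ₀ hab μY f (fun x : ℂ => ‖x‖ₑ) z
  · rw [Set.indicator_of_notMem (show z ∉ {y : (quasiSplit F E c 3).Adelic | T < borelHeight y} from hz)]
    have hpt : ∀ η : Quotient (QuotientGroup.rightRel ((arithmeticBorel F E c 3 ⊓ Subgroup.centralizer ({γ₀} : Set (quasiSplit F E c 3).arithmeticSubgroup)).subgroupOf (arithmeticBorel F E c 3))), {y : (quasiSplit F E c 3).Adelic | T < borelHeight y}.indicator (fun y : (quasiSplit F E c 3).Adelic => (μY (traceZeroFundamentalDomain F E c)).toReal⁻¹ • ∫ w : traceZeroAdele F E c, f (y⁻¹ * ((γ₀ : (quasiSplit F E c 3).Adelic) * (((heisElt hc 0 w : unipotentInBorel F E c 3) : borelAdelic F E c 3) : (quasiSplit F E c 3).Adelic)) * y) ∂μY) ((((η.out : arithmeticBorel F E c 3) : (quasiSplit F E c 3).arithmeticSubgroup) : (quasiSplit F E c 3).Adelic) * z) = 0 := fun η =>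
      Set.indicator_of_notMem (show (((η.out : arithmeticBorel F E c 3) : (quasiSplit F E c 3).arithmeticSubgroup) : (quasiSplit F E c 3).Adelic) * z ∉ {y : (quasiSplit F E c 3).Adelic | T < borelHeight y} by
        change ¬ T < borelHeight _; rw [borelHeight_quotientSub_out_mul γ₀]; exact hz) _
    simp only [hpt, enorm_zero, tsum_zero]

omit [BorelSpace (AdeleRing (𝓞 E) E)] in
/-- `Σ'_ξ ‖𝒯(u(ξ) z)‖ₑ < ∞` (finitely many non-zero terms, `finite_support_center_heis`). [cite: Rogawski1990, §7.2 Prop. 7.2.1 (pp. 91–92)] -/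
theorem tsum_enorm_center_heis_lt_top (hc : c * c = 1) {a b : Eˣ} {g₀ : (quasiSplit F E c 3).Rational} {γ₀ : (quasiSplit F E c 3).arithmeticSubgroup}
    (hg₀ : ((g₀.val : GL (Fin 3) E) : Matrix (Fin 3) (Fin 3) E) = !![(a : E), 0, 0; 0, b, 0; 0, 0, a])
    (hγ₀ : (γ₀ : (quasiSplit F E c 3).Adelic) = (quasiSplit F E c 3).toAdelic g₀)
    (hab : (a : E) ≠ (b : E)) (μY : Measure (traceZeroAdele F E c)) {f : (quasiSplit F E c 3).Adelic → ℂ} (hf : HasCompactSupport f) (z : (quasiSplit F E c 3).Adelic) :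
    (∑' ξ : E, ‖(μY (traceZeroFundamentalDomain F E c)).toReal⁻¹ • ∫ w : traceZeroAdele F E c, f (((((heisElt hc (algebraMap E (AdeleRing (𝓞 E) E) ξ) 0 : unipotentInBorel F E c 3) : borelAdelic F E c 3) : (quasiSplit F E c 3).Adelic) * z)⁻¹ * ((γ₀ : (quasiSplit F E c 3).Adelic) * (((heisElt hc 0 w : unipotentInBorel F E c 3) : borelAdelic F E c 3) : (quasiSplit F E c 3).Adelic)) * ((((heisElt hc (algebraMap E (AdeleRing (𝓞 E) E) ξ) 0 : unipotentInBorel F E c 3) : borelAdelic F E c 3) : (quasiSplit F E c 3).Adelic) * z)) ∂μY‖ₑ) < ⊤ := by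
  classical
  have hfs := finite_support_center_heis hc hg₀ hγ₀ hab μY hf z
  rw [tsum_eq_sum' (s := hfs.toFinset) ?_]
  · exact ENNReal.sum_lt_top.2 fun _ _ => enorm_lt_top
  · intro ξ hξ
    simp only [Function.mem_support, ne_eq] at hξ
    rw [Finset.mem_coe, Set.Finite.mem_toFinset, Function.mem_support]
    intro h0
    apply hξ
    rw [h0, enorm_zero]

/-- **The cut-off centre integrals are summable over `B_γ(F)\\G(F)`** (`T > 0`): through the `[0,∞]` two-step regrouping (★
`tsum_quotient_eq_tsum_tsum_quotient_of_le`) the `‖·‖ₑ`-series is a finite sum (★ `finite_setOf_lt_borelHeight`) of finite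
`ξ`-sums. [cite: Rogawski1990, §7.2 Prop. 7.2.1 (pp. 91–93)] -/
theorem summable_indicator_center_quotient (hc : c * c = 1) (hc1 : c ≠ 1) {a b : Eˣ} {g₀ : (quasiSplit F E c 3).Rational} {γ₀ : (quasiSplit F E c 3).arithmeticSubgroup}
    (hg₀ : ((g₀.val : GL (Fin 3) E) : Matrix (Fin 3) (Fin 3) E) = !![(a : E), 0, 0; 0, b, 0; 0, 0, a])
    (hγ₀ : (γ₀ : (quasiSplit F E c 3).Adelic) = (quasiSplit F E c 3).toAdelic g₀)
    (hab : (a : E) ≠ (b : E)) (μY : Measure (traceZeroAdele F E c)) [μY.IsAddHaarMeasure] [μY.Regular] {f : (quasiSplit F E c 3).Adelic → ℂ} (hf : HasCompactSupport f) {T : ℝ≥0} (hT : 0 < T)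
    (y : (quasiSplit F E c 3).Adelic) :
    Summable fun q : Quotient (QuotientGroup.rightRel (arithmeticBorel F E c 3 ⊓ Subgroup.centralizer ({γ₀} : Set (quasiSplit F E c 3).arithmeticSubgroup))) => {y : (quasiSplit F E c 3).Adelic | T < borelHeight y}.indicator
        (fun y : (quasiSplit F E c 3).Adelic => (μY (traceZeroFundamentalDomain F E c)).toReal⁻¹ • ∫ w : traceZeroAdele F E c, f (y⁻¹ * ((γ₀ : (quasiSplit F E c 3).Adelic) * (((heisElt hc 0 w : unipotentInBorel F E c 3) : borelAdelic F E c 3) : (quasiSplit F E c 3).Adelic)) * y) ∂μY) (((q.out : (quasiSplit F E c 3).arithmeticSubgroup) : (quasiSplit F E c 3).Adelic) * y) := by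
  classical
  have hle : (arithmeticBorel F E c 3 ⊓ Subgroup.centralizer ({γ₀} : Set (quasiSplit F E c 3).arithmeticSubgroup)) ≤ arithmeticBorel F E c 3 := inf_le_left
  have hψinv' : ∀ β ∈ (arithmeticBorel F E c 3 ⊓ Subgroup.centralizer ({γ₀} : Set (quasiSplit F E c 3).arithmeticSubgroup)), ∀ z : (quasiSplit F E c 3).Adelic,
      ‖{y : (quasiSplit F E c 3).Adelic | T < borelHeight y}.indicator (fun y : (quasiSplit F E c 3).Adelic => (μY (traceZeroFundamentalDomain F E c)).toReal⁻¹ • ∫ w : traceZeroAdele F E c, f (y⁻¹ * ((γ₀ : (quasiSplit F E c 3).Adelic) * (((heisElt hc 0 w : unipotentInBorel F E c 3) : borelAdelic F E c 3) : (quasiSplit F E c 3).Adelic)) * y) ∂μY) ((β : (quasiSplit F E c 3).Adelic) * z)‖ₑ =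
        ‖{y : (quasiSplit F E c 3).Adelic | T < borelHeight y}.indicator (fun y : (quasiSplit F E c 3).Adelic => (μY (traceZeroFundamentalDomain F E c)).toReal⁻¹ • ∫ w : traceZeroAdele F E c, f (y⁻¹ * ((γ₀ : (quasiSplit F E c 3).Adelic) * (((heisElt hc 0 w : unipotentInBorel F E c 3) : borelAdelic F E c 3) : (quasiSplit F E c 3).Adelic)) * y) ∂μY) z‖ₑ := by
    intro β hβ z
    rw [indicator_center_borelCentralizer_mul hc hc1 γ₀ μY T f hβ z]
  have hreg := tsum_quotient_eq_tsum_tsum_quotient_of_le hle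
    (ψ := fun z : (quasiSplit F E c 3).Adelic => ‖{y : (quasiSplit F E c 3).Adelic | T < borelHeight y}.indicator (fun y : (quasiSplit F E c 3).Adelic => (μY (traceZeroFundamentalDomain F E c)).toReal⁻¹ • ∫ w : traceZeroAdele F E c, f (y⁻¹ * ((γ₀ : (quasiSplit F E c 3).Adelic) * (((heisElt hc 0 w : unipotentInBorel F E c 3) : borelAdelic F E c 3) : (quasiSplit F E c 3).Adelic)) * y) ∂μY) z‖ₑ) hψinv' y
  have hlt : (∑' q : Quotient (QuotientGroup.rightRel (arithmeticBorel F E c 3 ⊓ Subgroup.centralizer ({γ₀} : Set (quasiSplit F E c 3).arithmeticSubgroup))), ‖{y : (quasiSplit F E c 3).Adelic | T < borelHeight y}.indicator (fun y : (quasiSplit F E c 3).Adelic => (μY (traceZeroFundamentalDomain F E c)).toReal⁻¹ • ∫ w : traceZeroAdele F E c, f (y⁻¹ * ((γ₀ : (quasiSplit F E c 3).Adelic) * (((heisElt hc 0 w : unipotentInBorel F E c 3) : borelAdelic F E c 3) : (quasiSplit F E c 3).Adelic)) * y) ∂μY) (((q.out : (quasiSplit F E c 3).arithmeticSubgroup)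 : (quasiSplit F E c 3).Adelic) * y)‖ₑ) < ⊤ := by
    rw [hreg]
    have hδ : ∀ δ : Quotient (QuotientGroup.rightRel (arithmeticBorel F E c 3)), (∑' η : Quotient (QuotientGroup.rightRel ((arithmeticBorel F E c 3 ⊓ Subgroup.centralizer ({γ₀} : Set (quasiSplit F E c 3).arithmeticSubgroup)).subgroupOf (arithmeticBorel F E c 3))),
        ‖{y : (quasiSplit F E c 3).Adelic | T < borelHeight y}.indicator (fun y : (quasiSplit F E c 3).Adelic => (μY (traceZeroFundamentalDomain F E c)).toReal⁻¹ • ∫ w : traceZeroAdele F E c, f (y⁻¹ * ((γ₀ : (quasiSplit F E c 3).Adelic) * (((heisElt hc 0 w : unipotentInBorel F E c 3) : borelAdelic F E c 3) : (quasiSplit F E c 3).Adelic)) * y) ∂μY) (((((η.out : arithmeticBorel F E c 3) : (quasiSplit F E c 3).arithmeticSubgroup) * δ.out : (quasiSplit F E c 3).arithmeticSubgroup) : (quasiSplit F E c 3).Adelic) * y)‖ₑ) =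
        {y : (quasiSplit F E c 3).Adelic | T < borelHeight y}.indicator (fun z : (quasiSplit F E c 3).Adelic => ∑' ξ : E, ‖(μY (traceZeroFundamentalDomain F E c)).toReal⁻¹ • ∫ w : traceZeroAdele F E c, f (((((heisElt hc (algebraMap E (AdeleRing (𝓞 E) E) ξ) 0 : unipotentInBorel F E c 3) : borelAdelic F E c 3) : (quasiSplit F E c 3).Adelic) * z)⁻¹ * ((γ₀ : (quasiSplit F E c 3).Adelic) * (((heisElt hc 0 w : unipotentInBorel F E c 3) : borelAdelic F E c 3) : (quasiSplit F E c 3).Adelic)) * ((((heisElt hc (algebraMap E (AdeleRing (𝓞 E) E) ξ) 0 : unipotentInBorel F E c 3) : borelAdelic F E c 3) : (quasiSplit F E c 3).Adelic) * z)) ∂μY‖ₑ) (((δ.out : (quasiSplit F E c 3).arithmeticSubgroup) : (quasiSplit F E c 3).Adelic) * y) := by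
      intro δ
      simp only [Subgroup.coe_mul, mul_assoc]
      have h := tsum_enorm_indicator_center_quotientSub_eq hc hc1 hg₀ hγ₀ hab μY f T (((δ.out : (quasiSplit F E c 3).arithmeticSubgroup) : (quasiSplit F E c 3).Adelic) * y)
      simpa only [mul_assoc] using h
    simp only [hδ]
    rw [tsum_eq_sum' (s := (finite_setOf_lt_borelHeight y hT).toFinset) ?_]
    · exact ENNReal.sum_lt_top.2 fun δ _ =>
        lt_of_le_of_lt (Set.indicator_apply_le' (fun _ => le_rfl) (fun _ => zero_le))
          (tsum_enorm_center_heis_lt_top hc hg₀ hγ₀ hab μY hf _)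
    · intro δ hδ'
      rw [Finset.mem_coe, Set.Finite.mem_toFinset]
      by_contra hnot
      exact hδ' (Set.indicator_of_notMem (s := {y : (quasiSplit F E c 3).Adelic | T < borelHeight y}) hnot _)
  have h1 : Summable fun q : Quotient (QuotientGroup.rightRel (arithmeticBorel F E c 3 ⊓ Subgroup.centralizer ({γ₀} : Set (quasiSplit F E c 3).arithmeticSubgroup))) => ‖{y : (quasiSplit F E c 3).Adelic | T < borelHeight y}.indicator (fun y : (quasiSplit F E c 3).Adelic => (μY (traceZeroFundamentalDomain F E c)).toReal⁻¹ • ∫ w : traceZeroAdele F E c, f (y⁻¹ * ((γ₀ : (quasiSplit F E c 3).Adelic) * (((heisElt hc 0 w : unipotentInBorel F E c 3) : borelAdelic F E c 3) : (quasiSplit F E c 3).Adelic)) * y) ∂μY) (((q.out : (quasiSplit F E c 3).arithmeticSubgroup) : (quasiSplit F E c 3).Adelic) * y)‖₊ := by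
    rw [← ENNReal.tsum_coe_ne_top_iff_summable]
    simpa only [enorm_eq_nnnorm] using hlt.ne
  exact .of_norm (by simpa only [coe_nnnorm] using NNReal.summable_coe.2 h1)

/-- **The cut-off centre integrals regroup to `Σ_{δ∈B(F)\\G(F)} (1_{T<H}P₀)(δ y)`** (`T > 0`): two-step regrouping ★
`summable_and_tsum_quotient_eq_tsum_tsum_quotient_of_le`, inner sums by `tsum_indicator_center_quotientSub_eq`, outer `tsum` =
pseudo-Eisenstein `finsum` by ★ `tsum_indicator_borelQuotient_eq_pseudoEisenstein`. [cite: Rogawski1990, §7.2 (7.2.3) pp. 92–93] -/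
theorem tsum_indicator_center_quotient_eq_pseudoEisenstein (hc : c * c = 1) (hc1 : c ≠ 1) {a b : Eˣ} {g₀ : (quasiSplit F E c 3).Rational} {γ₀ : (quasiSplit F E c 3).arithmeticSubgroup}
    (hg₀ : ((g₀.val : GL (Fin 3) E) : Matrix (Fin 3) (Fin 3) E) = !![(a : E), 0, 0; 0, b, 0; 0, 0, a])
    (hγ₀ : (γ₀ : (quasiSplit F E c 3).Adelic) = (quasiSplit F E c 3).toAdelic g₀)
    (hab : (a : E) ≠ (b : E)) (μY : Measure (traceZeroAdele F E c)) [μY.IsAddHaarMeasure] [μY.Regular] {f : (quasiSplit F E c 3).Adelic → ℂ} (hf : HasCompactSupport f) {T : ℝ≥0} (hT : 0 < T)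
    (y : (quasiSplit F E c 3).Adelic) :
    ∑' q : Quotient (QuotientGroup.rightRel (arithmeticBorel F E c 3 ⊓ Subgroup.centralizer ({γ₀} : Set (quasiSplit F E c 3).arithmeticSubgroup))), {y : (quasiSplit F E c 3).Adelic | T < borelHeight y}.indicator
        (fun y : (quasiSplit F E c 3).Adelic => (μY (traceZeroFundamentalDomain F E c)).toReal⁻¹ • ∫ w : traceZeroAdele F E c, f (y⁻¹ * ((γ₀ : (quasiSplit F E c 3).Adelic) * (((heisElt hc 0 w : unipotentInBorel F E c 3) : borelAdelic F E c 3) : (quasiSplit F E c 3).Adelic)) * y) ∂μY) (((q.out : (quasiSplit F E c 3).arithmeticSubgroup) : (quasiSplit F E c 3).Adelic) * y) =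
      pseudoEisenstein ({y : (quasiSplit F E c 3).Adelic | T < borelHeight y}.indicator (fun z : (quasiSplit F E c 3).Adelic => ∑' ξ : E, (μY (traceZeroFundamentalDomain F E c)).toReal⁻¹ • ∫ w : traceZeroAdele F E c, f (((((heisElt hc (algebraMap E (AdeleRing (𝓞 E) E) ξ) 0 : unipotentInBorel F E c 3) : borelAdelic F E c 3) : (quasiSplit F E c 3).Adelic) * z)⁻¹ * ((γ₀ : (quasiSplit F E c 3).Adelic) * (((heisElt hc 0 w : unipotentInBorel F E c 3) : borelAdelic F E c 3) : (quasiSplit F E c 3).Adelic)) * ((((heisElt hc (algebraMap E (AdeleRing (𝓞 E) E) ξ) 0 : unipotentInBorel F E c 3) : borelAdelic F E c 3) : (quasiSplit F E c 3).Adelic) * z)) ∂μY)) y := by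
  classical
  have hle : (arithmeticBorel F E c 3 ⊓ Subgroup.centralizer ({γ₀} : Set (quasiSplit F E c 3).arithmeticSubgroup)) ≤ arithmeticBorel F E c 3 := inf_le_left
  have hψinv : ∀ β ∈ (arithmeticBorel F E c 3 ⊓ Subgroup.centralizer ({γ₀} : Set (quasiSplit F E c 3).arithmeticSubgroup)), ∀ z : (quasiSplit F E c 3).Adelic,
      {y : (quasiSplit F E c 3).Adelic | T < borelHeight y}.indicator (fun y : (quasiSplit F E c 3).Adelic => (μY (traceZeroFundamentalDomain F E c)).toReal⁻¹ • ∫ w : traceZeroAdele F E c, f (y⁻¹ * ((γ₀ : (quasiSplit F E c 3).Adelic) * (((heisElt hc 0 w : unipotentInBorel F E c 3) : borelAdelic F E c 3) : (quasiSplit F E c 3).Adelic)) * y) ∂μY) ((β : (quasiSplit F E c 3).Adelic) * z) = {y : (quasiSplit F E c 3).Adelic | T < borelHeight y}.indicator (fun y : (quasiSplit F E c 3).Adelic => (μY (traceZeroFundamentalDomain F E c)).toReal⁻¹ • ∫ w : traceZeroAdele F E c, f (y⁻¹ * ((γ₀ : (quasiSplit F E c 3).Adelic) * (((heisElt hc 0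 w : unipotentInBorel F E c 3) : borelAdelic F E c 3) : (quasiSplit F E c 3).Adelic)) * y) ∂μY) z :=
    fun β hβ z => indicator_center_borelCentralizer_mul hc hc1 γ₀ μY T f hβ z
  obtain ⟨-, h2⟩ := summable_and_tsum_quotient_eq_tsum_tsum_quotient_of_le hle hψinv y
    (summable_indicator_center_quotient hc hc1 hg₀ hγ₀ hab μY hf hT y)
  rw [h2]
  have hδ : ∀ δ : Quotient (QuotientGroup.rightRel (arithmeticBorel F E c 3)), (∑' η : Quotient (QuotientGroup.rightRel ((arithmeticBorel F E c 3 ⊓ Subgroup.centralizer ({γ₀} : Set (quasiSplit F E c 3).arithmeticSubgroup)).subgroupOf (arithmeticBorel F E c 3))),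
      {y : (quasiSplit F E c 3).Adelic | T < borelHeight y}.indicator (fun y : (quasiSplit F E c 3).Adelic => (μY (traceZeroFundamentalDomain F E c)).toReal⁻¹ • ∫ w : traceZeroAdele F E c, f (y⁻¹ * ((γ₀ : (quasiSplit F E c 3).Adelic) * (((heisElt hc 0 w : unipotentInBorel F E c 3) : borelAdelic F E c 3) : (quasiSplit F E c 3).Adelic)) * y) ∂μY) (((((η.out : arithmeticBorel F E c 3) : (quasiSplit F E c 3).arithmeticSubgroup) * δ.out : (quasiSplit F E c 3).arithmeticSubgroup) : (quasiSplit F E c 3).Adelic) * y)) =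
      {y : (quasiSplit F E c 3).Adelic | T < borelHeight y}.indicator (fun z : (quasiSplit F E c 3).Adelic => ∑' ξ : E, (μY (traceZeroFundamentalDomain F E c)).toReal⁻¹ • ∫ w : traceZeroAdele F E c, f (((((heisElt hc (algebraMap E (AdeleRing (𝓞 E) E) ξ) 0 : unipotentInBorel F E c 3) : borelAdelic F E c 3) : (quasiSplit F E c 3).Adelic) * z)⁻¹ * ((γ₀ : (quasiSplit F E c 3).Adelic) * (((heisElt hc 0 w : unipotentInBorel F E c 3) : borelAdelic F E c 3) : (quasiSplit F E c 3).Adelic)) * ((((heisElt hc (algebraMap E (AdeleRing (𝓞 E) E) ξ) 0 : unipotentInBorel F E c 3) : borelAdelic F E c 3) : (quasiSplit F E c 3).Adelic) * z)) ∂μY) (((δ.out : (quasiSplit F E c 3).arithmeticSubgroup) : (quasiSplit F E c 3).Adelic) * y) := by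
    intro δ
    simp only [Subgroup.coe_mul, mul_assoc]
    have h := tsum_indicator_center_quotientSub_eq hc hc1 hg₀ hγ₀ hab μY f T (((δ.out : (quasiSplit F E c 3).arithmeticSubgroup) : (quasiSplit F E c 3).Adelic) * y)
    simpa only [mul_assoc] using h
  simp only [hδ]
  exact tsum_indicator_borelQuotient_eq_pseudoEisenstein _ hT y

end Comparison


section ComparisonMain

variable [MeasurableSpace (AdeleRing (𝓞 E) E)] [BorelSpace (AdeleRing (𝓞 E) E)]
  [MeasurableSpace (adelicUnipotent F E c 3)]

omit [BorelSpace (AdeleRing (𝓞 E) E)] in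
/-- **`Σ_δ (1_{T<H}𝓔)(δy) = Σ_δ (1_{T<H}K_{B,i♭})(δy) − Σ_δ (1_{T<H}P₀)(δy)`** (`T > 0`; the three pseudo-Eisenstein `finsum`s are
finite sums over the same finite set ★ `finite_setOf_lt_borelHeight`). [cite: Rogawski1990, §2.2 (p. 13); §7.2 (7.2.2) p. 92] -/
theorem pseudoEisenstein_indicator_singularDefect_eq_sub (hc : c * c = 1) {a b : Eˣ} (γ₀ : (quasiSplit F E c 3).arithmeticSubgroup)
    (ν : Measure (adelicUnipotent F E c 3)) (𝓕 : Set (adelicUnipotent F E c 3))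
    (μY : Measure (traceZeroAdele F E c)) (f : (quasiSplit F E c 3).Adelic → ℂ) {T : ℝ≥0} (hT : 0 < T) (y : (quasiSplit F E c 3).Adelic) :
    pseudoEisenstein ({y : (quasiSplit F E c 3).Adelic | T < borelHeight y}.indicator
        (fun z : (quasiSplit F E c 3).Adelic => kernelBorelClass ν 𝓕 (fun γ : (quasiSplit F E c 3).arithmeticSubgroup => (((adelicVal F E c 3 _ (γ : (quasiSplit F E c 3).Adelic) :
          GL (Fin 3) (AdeleRing (𝓞 E) E)) : Matrix (Fin 3) (Fin 3) (AdeleRing (𝓞 E) E)).charpoly,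
        decide (∃ δ : (quasiSplit F E c 3).arithmeticSubgroup, δ * γ * δ⁻¹ ∈ arithmeticBorel F E c 3)))
      ((Polynomial.map (algebraMap E (AdeleRing (𝓞 E) E)) ((X - C (a : E)) ^ 2 * (X - C (b : E)))), true) f z z -
        ∑' ξ : E, (μY (traceZeroFundamentalDomain F E c)).toReal⁻¹ • ∫ w : traceZeroAdele F E c, f (((((heisElt hc (algebraMap E (AdeleRing (𝓞 E) E) ξ) 0 : unipotentInBorel F E c 3) : borelAdelic F E c 3) : (quasiSplit F E c 3).Adelic) * z)⁻¹ * ((γ₀ : (quasiSplit F E c 3).Adelic) * (((heisElt hc 0 w : unipotentInBorel F E c 3) : borelAdelic F E c 3) : (quasiSplit F E c 3).Adelic)) * ((((heisElt hc (algebraMap E (AdeleRing (𝓞 E) E) ξ) 0 : unipotentInBorel F E c 3) : borelAdelic F E c 3) : (quasiSplit F E c 3).Adelic) * z)) ∂μY)) y =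
      pseudoEisenstein (kernelBorelTailClass ν 𝓕 T (fun γ : (quasiSplit F E c 3).arithmeticSubgroup => (((adelicVal F E c 3 _ (γ : (quasiSplit F E c 3).Adelic) :
          GL (Fin 3) (AdeleRing (𝓞 E) E)) : Matrix (Fin 3) (Fin 3) (AdeleRing (𝓞 E) E)).charpoly,
        decide (∃ δ : (quasiSplit F E c 3).arithmeticSubgroup, δ * γ * δ⁻¹ ∈ arithmeticBorel F E c 3))) ((Polynomial.map (algebraMap E (AdeleRing (𝓞 E) E)) ((X - C (a : E)) ^ 2 * (X - C (b : E)))), true) f) y -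
        pseudoEisenstein ({y : (quasiSplit F E c 3).Adelic | T < borelHeight y}.indicator (fun z : (quasiSplit F E c 3).Adelic => ∑' ξ : E, (μY (traceZeroFundamentalDomain F E c)).toReal⁻¹ • ∫ w : traceZeroAdele F E c, f (((((heisElt hc (algebraMap E (AdeleRing (𝓞 E) E) ξ) 0 : unipotentInBorel F E c 3) : borelAdelic F E c 3) : (quasiSplit F E c 3).Adelic) * z)⁻¹ * ((γ₀ : (quasiSplit F E c 3).Adelic) * (((heisElt hc 0 w : unipotentInBorel F E c 3) : borelAdelic F E c 3) : (quasiSplit F E c 3).Adelic)) * ((((heisElt hc (algebraMap E (AdeleRing (𝓞 E) E) ξ) 0 : unipotentInBorel F E c 3) : borelAdelic F E c 3) : (quasiSplit F E c 3).Adelic) * z)) ∂μY)) y := by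
  classical
  have hfin := finite_setOf_lt_borelHeight y hT
  have hsupp : ∀ D : (quasiSplit F E c 3).Adelic → ℂ, (Function.support fun q : Quotient (QuotientGroup.rightRel (arithmeticBorel F E c 3)) =>
      ({y : (quasiSplit F E c 3).Adelic | T < borelHeight y}.indicator D) (((q.out : (quasiSplit F E c 3).arithmeticSubgroup) : (quasiSplit F E c 3).Adelic) * y)) ⊆ ↑hfin.toFinset := by
    intro D q hq
    rw [Finset.mem_coe, Set.Finite.mem_toFinset]
    by_contra hnot
    exact hq (Set.indicator_of_notMem (s := {y : (quasiSplit F E c 3).Adelic | T < borelHeight y}) hnot D)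
  have hs : ∀ D : (quasiSplit F E c 3).Adelic → ℂ, Summable fun q : Quotient (QuotientGroup.rightRel (arithmeticBorel F E c 3)) => ({y : (quasiSplit F E c 3).Adelic | T < borelHeight y}.indicator D) (((q.out : (quasiSplit F E c 3).arithmeticSubgroup) : (quasiSplit F E c 3).Adelic) * y) :=
    fun D => summable_of_hasFiniteSupport (hfin.toFinset.finite_toSet.subset (hsupp D))
  rw [← tsum_indicator_borelQuotient_eq_pseudoEisenstein _ hT y, kernelBorelTailClass,
    ← tsum_indicator_borelQuotient_eq_pseudoEisenstein _ hT y, ← tsum_indicator_borelQuotient_eq_pseudoEisenstein _ hT y,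
    ← (hs _).tsum_sub (hs _)]
  refine tsum_congr fun q => ?_
  by_cases hq : T < borelHeight (((q.out : (quasiSplit F E c 3).arithmeticSubgroup) : (quasiSplit F E c 3).Adelic) * y)
  · rw [Set.indicator_of_mem (show ((q.out : (quasiSplit F E c 3).arithmeticSubgroup) : (quasiSplit F E c 3).Adelic) * y ∈ {y : (quasiSplit F E c 3).Adelic | T < borelHeight y} from hq),
      Set.indicator_of_mem (show ((q.out : (quasiSplit F E c 3).arithmeticSubgroup) : (quasiSplit F E c 3).Adelic) * y ∈ {y : (quasiSplit F E c 3).Adelic | T < borelHeight y} from hq),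
      Set.indicator_of_mem (show ((q.out : (quasiSplit F E c 3).arithmeticSubgroup) : (quasiSplit F E c 3).Adelic) * y ∈ {y : (quasiSplit F E c 3).Adelic | T < borelHeight y} from hq)]
  · rw [Set.indicator_of_notMem (show ((q.out : (quasiSplit F E c 3).arithmeticSubgroup) : (quasiSplit F E c 3).Adelic) * y ∉ {y : (quasiSplit F E c 3).Adelic | T < borelHeight y} from hq),
      Set.indicator_of_notMem (show ((q.out : (quasiSplit F E c 3).arithmeticSubgroup) : (quasiSplit F E c 3).Adelic) * y ∉ {y : (quasiSplit F E c 3).Adelic | T < borelHeight y} from hq),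
      Set.indicator_of_notMem (show ((q.out : (quasiSplit F E c 3).arithmeticSubgroup) : (quasiSplit F E c 3).Adelic) * y ∉ {y : (quasiSplit F E c 3).Adelic | T < borelHeight y} from hq), sub_zero]

/-- **THE COMPARISON IDENTITY (pointwise, every `y ∈ G(𝔸_F)`, `T ≥ 1`... in fact `T > 0`).**  For the singular class `i♭`
with base point `γ₀ = ι(d(a,b,a))` (`a ≠ b`, `c a·a = c b·b = 1`), `f ∈ C_c(G(𝔸_F))` and A-p19's bracket
`b_T(y) = Σ'_{n ∈ N_γ(F)∖1} f(y⁻¹(nγ₀)y) − 1_{T<H(y)}·𝒯(y)`: the `B_γ(F)\\G(F)`-coset series of `b_T` is summable and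

  `Σ'_{q ∈ B_γ(F)\\G(F)} b_T(q̃ y) = k^T_{i♭}(y) − Σ'_{s ∈ [γ₀]} f(y⁻¹ s y) + Σ_{δ ∈ B(F)\\G(F)} (1_{T<H}·𝓔)(δ y)`,

`𝓔(z) = K_{B,i♭}(z,z) − Σ'_{ξ∈E} 𝒯(u(ξ) z)`. The `n`-sums regroup to `K_{i♭}(y,y) − S(y)` (`summable_and_tsum_nsum_quotient_eq`);
the cut-off centre integrals to `Σ_δ (1_{T<H}P₀)(δy)` (`tsum_indicator_center_quotient_eq_pseudoEisenstein`); and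
`k^T_{i♭} = K_{i♭} − Σ_δ (1_{T<H} K_{B,i♭})(δ·)` (★ `truncatedKernelClass_def`). No support lemma and no `N`-regularity is used:
this is what replaces ★ FILE 1's collapse at the singular class. [cite: Rogawski1990, §7.2 Prop. 7.2.1, (7.2.2)–(7.2.3) (pp. 91–93)]
[cite: Arthur1978TraceFormulaI, §8] -/
theorem summable_and_tsum_singularBracket_quotient_eq (hc : c * c = 1) (hc1 : c ≠ 1) {a b : Eˣ} {g₀ : (quasiSplit F E c 3).Rational} {γ₀ : (quasiSplit F E c 3).arithmeticSubgroup}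
    (hg₀ : ((g₀.val : GL (Fin 3) E) : Matrix (Fin 3) (Fin 3) E) = !![(a : E), 0, 0; 0, b, 0; 0, 0, a])
    (hγ₀ : (γ₀ : (quasiSplit F E c 3).Adelic) = (quasiSplit F E c 3).toAdelic g₀)
    (hab : (a : E) ≠ (b : E)) (ha : c (a : E) * (a : E) = 1) (hb : c (b : E) * (b : E) = 1)
    (ν : Measure (adelicUnipotent F E c 3)) (𝓕 : Set (adelicUnipotent F E c 3))
    (μY : Measure (traceZeroAdele F E c)) [μY.IsAddHaarMeasure] [μY.Regular] {f : (quasiSplit F E c 3).Adelic → ℂ} (hf : HasCompactSupport f) {T : ℝ≥0} (hT : 0 < T)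
    (y : (quasiSplit F E c 3).Adelic) :
    (Summable fun q : Quotient (QuotientGroup.rightRel (arithmeticBorel F E c 3 ⊓ Subgroup.centralizer ({γ₀} : Set (quasiSplit F E c 3).arithmeticSubgroup))) =>
      ((∑' n : {n : ↥((adelicUnipotent F E c 3).subgroupOf (quasiSplit F E c 3).arithmeticSubgroup ⊓
        Subgroup.centralizer ({γ₀} : Set (quasiSplit F E c 3).arithmeticSubgroup)) // n ≠ 1},
      f ((((q.out : (quasiSplit F E c 3).arithmeticSubgroup) : (quasiSplit F E c 3).Adelic) * y)⁻¹ * (((n.1 : (quasiSplit F E c 3).arithmeticSubgroup) * γ₀ : (quasiSplit F E c 3).arithmeticSubgroup) : (quasiSplit F E c 3).Adelic) * (((q.out : (quasiSplit F E c 3).arithmeticSubgroup) : (quasiSplit F E c 3).Adelic) * y))) -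
      Set.indicator {y : (quasiSplit F E c 3).Adelic | T < borelHeight y}
        (fun y : (quasiSplit F E c 3).Adelic => (μY (traceZeroFundamentalDomain F E c)).toReal⁻¹ • ∫ w : traceZeroAdele F E c, f (y⁻¹ * ((γ₀ : (quasiSplit F E c 3).Adelic) * (((heisElt hc 0 w : unipotentInBorel F E c 3) : borelAdelic F E c 3) : (quasiSplit F E c 3).Adelic)) * y) ∂μY) (((q.out : (quasiSplit F E c 3).arithmeticSubgroup) : (quasiSplit F E c 3).Adelic) * y))) ∧
    ∑' q : Quotient (QuotientGroup.rightRel (arithmeticBorel F E c 3 ⊓ Subgroup.centralizer ({γ₀} : Set (quasiSplit F E c 3).arithmeticSubgroup))),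
      ((∑' n : {n : ↥((adelicUnipotent F E c 3).subgroupOf (quasiSplit F E c 3).arithmeticSubgroup ⊓
        Subgroup.centralizer ({γ₀} : Set (quasiSplit F E c 3).arithmeticSubgroup)) // n ≠ 1},
      f ((((q.out : (quasiSplit F E c 3).arithmeticSubgroup) : (quasiSplit F E c 3).Adelic) * y)⁻¹ * (((n.1 : (quasiSplit F E c 3).arithmeticSubgroup) * γ₀ : (quasiSplit F E c 3).arithmeticSubgroup) : (quasiSplit F E c 3).Adelic) * (((q.out : (quasiSplit F E c 3).arithmeticSubgroup) : (quasiSplit F E c 3).Adelic) * y))) -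
      Set.indicator {y : (quasiSplit F E c 3).Adelic | T < borelHeight y}
        (fun y : (quasiSplit F E c 3).Adelic => (μY (traceZeroFundamentalDomain F E c)).toReal⁻¹ • ∫ w : traceZeroAdele F E c, f (y⁻¹ * ((γ₀ : (quasiSplit F E c 3).Adelic) * (((heisElt hc 0 w : unipotentInBorel F E c 3) : borelAdelic F E c 3) : (quasiSplit F E c 3).Adelic)) * y) ∂μY) (((q.out : (quasiSplit F E c 3).arithmeticSubgroup) : (quasiSplit F E c 3).Adelic) * y)) =
      truncatedKernelClass ν 𝓕 T (fun γ : (quasiSplit F E c 3).arithmeticSubgroup => (((adelicVal F E c 3 _ (γ : (quasiSplit F E c 3).Adelic) :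
          GL (Fin 3) (AdeleRing (𝓞 E) E)) : Matrix (Fin 3) (Fin 3) (AdeleRing (𝓞 E) E)).charpoly,
        decide (∃ δ : (quasiSplit F E c 3).arithmeticSubgroup, δ * γ * δ⁻¹ ∈ arithmeticBorel F E c 3)))
          ((Polynomial.map (algebraMap E (AdeleRing (𝓞 E) E)) ((X - C (a : E)) ^ 2 * (X - C (b : E)))), true) f y -
        (∑' s : ↥(conjOrbit (quasiSplit F E c 3).arithmeticSubgroup (γ₀ : (quasiSplit F E c 3).Adelic)), f (y⁻¹ * (s : (quasiSplit F E c 3).Adelic) * y)) +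
        pseudoEisenstein ({y : (quasiSplit F E c 3).Adelic | T < borelHeight y}.indicator
          (fun z : (quasiSplit F E c 3).Adelic => kernelBorelClass ν 𝓕 (fun γ : (quasiSplit F E c 3).arithmeticSubgroup => (((adelicVal F E c 3 _ (γ : (quasiSplit F E c 3).Adelic) :
          GL (Fin 3) (AdeleRing (𝓞 E) E)) : Matrix (Fin 3) (Fin 3) (AdeleRing (𝓞 E) E)).charpoly,
        decide (∃ δ : (quasiSplit F E c 3).arithmeticSubgroup, δ * γ * δ⁻¹ ∈ arithmeticBorel F E c 3)))
      ((Polynomial.map (algebraMap E (AdeleRing (𝓞 E) E)) ((X - C (a : E)) ^ 2 * (X - C (b : E)))), true) f z z -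
        ∑' ξ : E, (μY (traceZeroFundamentalDomain F E c)).toReal⁻¹ • ∫ w : traceZeroAdele F E c, f (((((heisElt hc (algebraMap E (AdeleRing (𝓞 E) E) ξ) 0 : unipotentInBorel F E c 3) : borelAdelic F E c 3) : (quasiSplit F E c 3).Adelic) * z)⁻¹ * ((γ₀ : (quasiSplit F E c 3).Adelic) * (((heisElt hc 0 w : unipotentInBorel F E c 3) : borelAdelic F E c 3) : (quasiSplit F E c 3).Adelic)) * ((((heisElt hc (algebraMap E (AdeleRing (𝓞 E) E) ξ) 0 : unipotentInBorel F E c 3) : borelAdelic F E c 3) : (quasiSplit F E c 3).Adelic) * z)) ∂μY)) y := by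
  obtain ⟨hAsum, hAeq⟩ := summable_and_tsum_nsum_quotient_eq hc hg₀ hγ₀ hab ha hb hf y
  have hPsum := summable_indicator_center_quotient hc hc1 hg₀ hγ₀ hab μY hf hT y
  have hPeq := tsum_indicator_center_quotient_eq_pseudoEisenstein hc hc1 hg₀ hγ₀ hab μY hf hT y
  refine ⟨hAsum.sub hPsum, ?_⟩
  rw [hAsum.tsum_sub hPsum, hAeq, hPeq, truncatedKernelClass_def,
    pseudoEisenstein_indicator_singularDefect_eq_sub hc γ₀ ν 𝓕 μY f hT y]
  ring

end ComparisonMain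

end UnitaryGroup

end Literature.NumberTheory.Automorphic

end
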